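import Literature.Probability.Percolation.ZdFiveArmSeparatedGluing
import Literature.Probability.Percolation.FourArmGarbanFencedToSides
import Literature.Probability.Percolation.FiniteEnergy
import Literature.Probability.Percolation.ZdFiveArmKSZOfArms
import Literature.Probability.Percolation.KSTPeriodicArmDualityPlanar
import HarnessLib

/-!
# The point upper bound of the five-arm probability on `ℤ²` from Kesten's separation theorem

Topic `Literature/Probability/Percolation`; critical bond percolation on `ℤ²`.  This file proves
the step `(U)` of the printed proof of `P[𝒜₅(A_{m,n})] ≍ (m/n)²`
(`DuminilCopinManolescuTassion2021_zdFiveArm_upperBound`, `ZdFiveArmUpperBound.lean`) as a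
CONDITIONAL theorem: Kesten's arm-separation lower bound
`c · P(zdFiveArmClusters n N) ≤ P(zdFiveArmSep n N)` (`n ≥ n₀`, `2n ≤ N`; Kesten 1987, Lemma 4;
Nolin 2008, Thm. 11 — not yet in the tree) is the explicit hypothesis `hsep` of the final theorem
`zdFiveArm_pointBound_of_separation`, whose conclusion is the point bound
`P(zdFiveArmClusters k N) ≤ C / N²` (`N ≥ k = max n₀ 128`) of KSZ 1998, Lemma 5 / Nolin 2008,
Thm. 24 (3).  Everything else is proved here, following Nolin 2008, §4.5 (Prop. 17, arms going up
to a single site) and §5.2 (proof of Thm. 24) rendered for bond percolation on `ℤ²`: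

* **The hub** (`hubOpen`, `hubPairs`, `zdHub`, `le_real_zdHub`, `exists_hubWalkRpos/Rneg/L`,
  `exists_hubDualPathT/B`): a deterministic pattern on the pairs touching `B(k/2 - 1)` — three
  open combs from the origin facing the inner landing bands of the three open arms, everything
  else closed — of probability `≥ 2^{-|hubPairs|}`; it carries open walks from the origin to every
  tooth tip and closed-dual face paths from the face rows `±k/2 ∓ …` to the faces around the
  origin.
* **The corridors** (`uCorrOpen`: six `lrCrossingAt`; `uCorrDual`: four `dualFaceCrossing` — the
  face-walk form of `dualTBCrossingAt` — and two closed rows `rowClosed`), their pair sets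
  `uPairsP`, `uPairsM`, the common pairs `uPairsS` (zone pairs that are not corridor pairs), and the
  geometry `(G1)–(G4)` making `S, P, M` and `hubPairs` pairwise disjoint.
* **The probability of the glued event** `uGlued = zdFiveArmSep ∩ corridors ∩ hub`
  (`real_uGlued_ge`): generalised FKG (`bondPercolation_locallyMonotone_fkg`, Nolin 2008,
  Lemma 13), RSW at aspect ratio `1024` (`rsw_lowerBound_holds`), Harris, independence of the hub.
* **The deterministic inclusion** (`uGlued_openArms`, `uGlued_dualArms`,
  `relabel_shift_mem_zdFiveArmKSZ_of_mem_uGlued`): on `uGlued` the gluing lemmas of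
  `ZdFiveArmSeparatedGluing.lean` produce three open walks from the origin to the sides
  `{x₀ = -WL}`, `{x₀ = ER}` (twice) and two closed-dual face walks from the faces around the origin
  to the face rows `NT` and `-SB-1`; translated by `v = (WL, SB)` and made into paths they witness
  KSZ's landed event `zdFiveArmKSZ (WL+ER) (SB+NT) v` (`ZdFiveArmKSZOfArms.lean`), the left–right
  disjointness coming from the dual arms (`ZdFiveArmKSZ.mem_support_of_dual`).
* **Counting** (`real_zdFiveArmSep_mul_le_one`): summing over the `(2N+1)²` centres
  `v ∈ [3N, 5N]²` of the rectangle `[0, 8N]²`, `Σ_v P(A_v) ≤ 1` (`sum_real_zdFiveArmKSZ_le_one`)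
  gives `(2N+1)² · const_k · P(zdFiveArmSep k N) ≤ 1`.

No named fact is introduced; the separation theorem enters only as the hypothesis `hsep`.

## References

* H. Kesten, *Scaling relations for 2D-percolation*, CMP 109 (1987), Lemma 4, Lemma 6, (2.43)
  [KestenScalingCMP1987].
* H. Kesten, V. Sidoravicius, Y. Zhang, EJP 3 (1998), Lemma 5, (3.10)–(3.11)
  [KestenSidoraviciusZhang1998].
* P. Nolin, EJP 13 (2008), §4.3 Prop. 12, Lemma 13; §4.5 Prop. 17; §5.2 Thm. 24 [Nolin2008].
* H. Duminil-Copin, I. Manolescu, V. Tassion, PTRF 181 (2021), §6.2–6.4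
  [DuminilCopinManolescuTassion2021].

Tree: `ZdFiveArmSeparatedGluing.lean`, `ZdFiveArmSeparated.lean`, `ZdFiveArmKSZOfArms.lean`,
`ZdFiveArmUniqueness.lean`, `BondLocallyMonotoneFKG.lean`, `FiniteEnergy.lean`,
`CrossingChains.lean` (`lrCrossingAt`), `HarrisTheorem.lean` (`determinedBy_openCrossing_image`),
`RSWLemma.lean` (`rsw_lowerBound_holds`), `AnnulusCircuitsProofs.lean`
(`exists_faceWalk_of_mem_dualTBCrossingAt`), `BondPercolationSymmetry.lean`
(`bondPercolation_real_preimage_shift`), `SiteConnectionTools.lean` (`zdShiftIso`).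
-/

noncomputable section

open Set _root_.MeasureTheory

namespace Literature.Probability.Percolation

open LatticeModels SimpleGraph

/-! ### The hub: a deterministic local pattern around the centre -/

section Hub

open scoped Classical

/-- **The open comb of the hub** with parameters `K, a, h`: the vertical spine `{0} × [-a, a]`,
the rows `±a` from the column `0` to the column `K` and the row `0` from `-K` to `0`, the tooth
columns `{K} × [a, a+h]`, `{K} × [-a-h, -a]`, `{-K} × [0, h]`, and the teeth
`{(K, r), (K+1, r)}` (`a ≤ |r| ≤ a + h`, `r` of either sign) and `{(-K-1, r), (-K, r)}`
(`0 ≤ r ≤ h`).  Three open trees from the origin ending in combs facing the three open landing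
arcs of the inner corridors (the device replacing, at the innermost scale, Kesten's extension of
arms down to a single site; cost `2^{-O(K²)}`). [folklore] -/
def hubOpen (K a h : ℕ) : Set (Sym2 (Site 2)) :=
  {e | (∃ v : Site 2, e = s(v, v + Pi.single 1 1) ∧
        ((v 0 = 0 ∧ -(a : ℤ) ≤ v 1 ∧ v 1 + 1 ≤ a) ∨
         (v 0 = K ∧ (a : ℤ) ≤ v 1 ∧ v 1 + 1 ≤ a + h) ∨
         (v 0 = K ∧ -((a : ℤ) + h) ≤ v 1 ∧ v 1 + 1 ≤ -(a : ℤ)) ∨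
         (v 0 = -(K : ℤ) ∧ 0 ≤ v 1 ∧ v 1 + 1 ≤ h))) ∨
      (∃ v : Site 2, e = s(v, v + Pi.single 0 1) ∧
        ((v 1 = a ∧ 0 ≤ v 0 ∧ v 0 + 1 ≤ K) ∨
         (v 1 = -(a : ℤ) ∧ 0 ≤ v 0 ∧ v 0 + 1 ≤ K) ∨
         (v 1 = 0 ∧ -(K : ℤ) ≤ v 0 ∧ v 0 + 1 ≤ 0) ∨
         (v 0 = K ∧ (a : ℤ) ≤ v 1 ∧ v 1 ≤ a + h) ∨
         (v 0 = K ∧ -((a : ℤ) + h) ≤ v 1 ∧ v 1 ≤ -(a : ℤ)) ∨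
         (v 0 + 1 = -(K : ℤ) ∧ 0 ≤ v 1 ∧ v 1 ≤ h)))}

/-- Every pair of the open comb is a lattice edge. [folklore] -/
theorem hubOpen_subset_edgeSet (K a h : ℕ) : hubOpen K a h ⊆ (zdGraph 2).edgeSet := by
  rintro e (⟨v, rfl, -⟩ | ⟨v, rfl, -⟩)
  · exact single_edge_mem v 1
  · exact single_edge_mem v 0

/-- **The forced pairs of the hub**: the pairs of sites of `B(K+1)` with a member in `B(K)` (all
lattice edges with an endpoint in `B(K)`, and harmlessly some non-edges). [folklore] -/
def hubPairs (K : ℕ) : Finset (Sym2 (Site 2)) :=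
  ((box 2 (K + 1)).sym2).filter fun e => ∃ x ∈ e, x ∈ box 2 K

/-- A lattice edge with an endpoint in `B(K)` is a forced pair of the hub. [folklore] -/
theorem mem_hubPairs_of_adj {K : ℕ} {x y : Site 2} (hxy : (zdGraph 2).Adj x y) (hx : x ∈ box 2 K ∨ y ∈ box 2 K) :
    s(x, y) ∈ hubPairs K := by
  rw [hubPairs, Finset.mem_filter, Finset.mk_mem_sym2_iff, mem_box, mem_box]
  have hle := zdGraph_adj_apply_le hxy
  refine ⟨⟨fun i => ?_, fun i => ?_⟩, ?_⟩
  · rcases hx with hx | hx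
    · have := (mem_box.1 hx) i; push_cast; omega
    · have := (mem_box.1 hx) i; have := hle i; push_cast; omega
  · rcases hx with hx | hx
    · have := (mem_box.1 hx) i; have := hle i; push_cast; omega
    · have := (mem_box.1 hx) i; push_cast; omega
  · rcases hx with hx | hx
    · exact ⟨x, Sym2.mem_mk_left _ _, hx⟩
    · exact ⟨y, Sym2.mem_mk_right _ _, hx⟩

/-- **The hub event**: on the forced pairs, the configuration IS the open comb. [folklore] -/
def zdHub (K a h : ℕ) : Set (BondConfig (Site 2)) :=
  {ω | ∀ e ∈ hubPairs K, e ∈ ω ↔ e ∈ hubOpen K a h}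

/-- The hub event is determined by the forced pairs. [folklore] -/
theorem determinedBy_zdHub (K a h : ℕ) : DeterminedBy (zdHub K a h) ↑(hubPairs K) := by
  rw [determinedBy_iff]
  intro ω ω' hF
  have agree : ∀ e ∈ hubPairs K, (e ∈ ω ↔ e ∈ ω') := fun e he =>
    ⟨fun h => ((Set.ext_iff.1 hF e).1 ⟨h, he⟩).1, fun h => ((Set.ext_iff.1 hF e).2 ⟨h, he⟩).1⟩
  exact ⟨fun h e he => (agree e he).symm.trans (h e he), fun h e he => (agree e he).trans (h e he)⟩

/-- The hub event is measurable. [folklore] -/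
theorem measurableSet_zdHub (K a h : ℕ) : MeasurableSet (zdHub K a h) :=
  (determinedBy_zdHub K a h).measurableSet_of_finset

/-- **The hub event has positive probability**, at least `2^{-|hubPairs K|}` at `p = 1/2`: it is
the intersection of "the comb pairs are open" and "the other forced pairs are closed", two
independent events of probabilities `(1/2)^{#comb}` and `≥ (1/2)^{#others}`. [folklore] -/
theorem le_real_zdHub (K a h : ℕ) :
    (1 / 2 : ℝ) ^ (hubPairs K).card ≤ (bondPercolation (zdGraph 2) half).real (zdHub K a h) := by
  classical
  set O := (hubPairs K).filter (· ∈ hubOpen K a h) with hO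
  set Cl := (hubPairs K).filter (· ∉ hubOpen K a h) with hCl
  have hsub : {ω : BondConfig (Site 2) | (↑O : Set (Sym2 (Site 2))) ⊆ ω} ∩ {ω | ∀ e ∈ Cl, e ∉ ω} ⊆ zdHub K a h := by
    rintro ω ⟨h1, h2⟩ e he
    by_cases heO : e ∈ hubOpen K a h
    · exact ⟨fun _ => heO, fun _ => h1 (by rw [Finset.mem_coe, hO, Finset.mem_filter]; exact ⟨he, heO⟩)⟩
    · exact ⟨fun heω => absurd heω (h2 e (by rw [hCl, Finset.mem_filter]; exact ⟨he, heO⟩)), fun h => absurd h heO⟩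
  have hdetO : DeterminedBy {ω : BondConfig (Site 2) | (↑O : Set (Sym2 (Site 2))) ⊆ ω} ↑O := by
    rw [determinedBy_iff]
    intro ω ω' hF
    constructor
    · intro h e he; exact ((Set.ext_iff.1 hF e).1 ⟨h he, he⟩).1
    · intro h e he; exact ((Set.ext_iff.1 hF e).2 ⟨h he, he⟩).1
  have hmeasO : MeasurableSet {ω : BondConfig (Site 2) | (↑O : Set (Sym2 (Site 2))) ⊆ ω} :=
    hdetO.measurableSet_of_finset
  have hdisj : Disjoint (↑O : Set (Sym2 (Site 2))) ↑Cl := by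
    rw [Finset.disjoint_coe, hO, hCl]
    exact Finset.disjoint_filter_filter_not _ _ _
  have hind := bondPercolation_real_inter_of_disjoint (zdGraph 2) half hdisj hdetO
    (determinedBy_forall_notMem Cl) hmeasO (measurableSet_forall_notMem Cl)
  have hPO : (bondPercolation (zdGraph 2) half).real {ω : BondConfig (Site 2) | (↑O : Set (Sym2 (Site 2))) ⊆ ω} =
      (1 / 2 : ℝ) ^ O.card := by
    rw [bondPercolation_real_setOf_subset (zdGraph 2) half O (fun e he => ?_), coe_half]
    rw [Finset.mem_coe, hO, Finset.mem_filter] at he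
    exact hubOpen_subset_edgeSet K a h he.2
  have hPC : (1 / 2 : ℝ) ^ Cl.card ≤ (bondPercolation (zdGraph 2) half).real {ω : BondConfig (Site 2) | ∀ e ∈ Cl, e ∉ ω} := by
    have := le_bondPercolation_real_forall_notMem (zdGraph 2) half Cl
    rwa [coe_half, show (1 : ℝ) - 1 / 2 = 1 / 2 by norm_num] at this
  have hcard : O.card + Cl.card = (hubPairs K).card := by
    rw [hO, hCl]; exact Finset.card_filter_add_card_filter_not _
  calc (1 / 2 : ℝ) ^ (hubPairs K).card = (1 / 2 : ℝ) ^ O.card * (1 / 2) ^ Cl.card := by rw [← pow_add, hcard]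
    _ ≤ (bondPercolation (zdGraph 2) half).real {ω : BondConfig (Site 2) | (↑O : Set (Sym2 (Site 2))) ⊆ ω} *
          (bondPercolation (zdGraph 2) half).real {ω : BondConfig (Site 2) | ∀ e ∈ Cl, e ∉ ω} := by
        rw [hPO]; exact mul_le_mul_of_nonneg_left hPC (by positivity)
    _ = (bondPercolation (zdGraph 2) half).real ({ω : BondConfig (Site 2) | (↑O : Set (Sym2 (Site 2))) ⊆ ω} ∩ {ω | ∀ e ∈ Cl, e ∉ ω}) :=
        hind.symm
    _ ≤ _ := measureReal_mono hsub

end Hub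

/-! ### The hub: explicit open walks and dual paths -/

section HubPaths

variable {K a h : ℕ}

/-- Membership of a vertical unit edge in the open comb. [folklore] -/
theorem mk_add_single_one_mem_hubOpen_iff {w : Site 2} :
    s(w, w + Pi.single 1 1) ∈ hubOpen K a h ↔
      ((w 0 = 0 ∧ -(a : ℤ) ≤ w 1 ∧ w 1 + 1 ≤ a) ∨
       (w 0 = K ∧ (a : ℤ) ≤ w 1 ∧ w 1 + 1 ≤ a + h) ∨
       (w 0 = K ∧ -((a : ℤ) + h) ≤ w 1 ∧ w 1 + 1 ≤ -(a : ℤ)) ∨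
       (w 0 = -(K : ℤ) ∧ 0 ≤ w 1 ∧ w 1 + 1 ≤ h)) := by
  constructor
  · rintro (⟨v, hv, hc⟩ | ⟨v, hv, -⟩)
    · rw [mk_add_single_one_eq_iff.1 hv]; exact hc
    · exact absurd hv.symm (mk_add_single_zero_ne_mk_add_single_one v w)
  · intro hc; exact Or.inl ⟨w, rfl, hc⟩

/-- Membership of a horizontal unit edge in the open comb. [folklore] -/
theorem mk_add_single_zero_mem_hubOpen_iff {w : Site 2} :
    s(w, w + Pi.single 0 1) ∈ hubOpen K a h ↔
      ((w 1 = a ∧ 0 ≤ w 0 ∧ w 0 + 1 ≤ K) ∨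
       (w 1 = -(a : ℤ) ∧ 0 ≤ w 0 ∧ w 0 + 1 ≤ K) ∨
       (w 1 = 0 ∧ -(K : ℤ) ≤ w 0 ∧ w 0 + 1 ≤ 0) ∨
       (w 0 = K ∧ (a : ℤ) ≤ w 1 ∧ w 1 ≤ a + h) ∨
       (w 0 = K ∧ -((a : ℤ) + h) ≤ w 1 ∧ w 1 ≤ -(a : ℤ)) ∨
       (w 0 + 1 = -(K : ℤ) ∧ 0 ≤ w 1 ∧ w 1 ≤ h)) := by
  constructor
  · rintro (⟨v, hv, -⟩ | ⟨v, hv, hc⟩)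
    · exact absurd hv (mk_add_single_zero_ne_mk_add_single_one w v)
    · rw [mk_add_single_zero_eq_iff.1 hv]; exact hc
  · intro hc; exact Or.inr ⟨w, rfl, hc⟩

/-- **The hub walk to a tooth of the upper right comb**: for `a ≤ t ≤ a + h`, an open-comb walk from
the origin to `(K + 1, t)` — up the spine to `(0, a)`, along the row `a` to `(K, a)`, along the
tooth column to `(K, t)`, one step right. [folklore] -/
theorem exists_hubWalkRpos (K a h : ℕ) {t : ℤ} (ht : (a : ℤ) ≤ t) (ht' : t ≤ a + h) :
    ∃ (tip : Site 2) (U : (zdGraph 2).Walk 0 tip), tip 0 = K + 1 ∧ tip 1 = t ∧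
      (∀ z ∈ U.support, (z 0 = 0 ∧ 0 ≤ z 1 ∧ z 1 ≤ a) ∨ (z 1 = a ∧ 0 ≤ z 0 ∧ z 0 ≤ K) ∨
        (z 0 = K ∧ (a : ℤ) ≤ z 1 ∧ z 1 ≤ a + h) ∨ (z 0 = K + 1 ∧ z 1 = t)) ∧
      ∀ e ∈ U.edges, e ∈ hubOpen K a h := by
  set z₁ : Site 2 := ![0, a] with hz₁
  set z₂ : Site 2 := ![K, a] with hz₂
  set z₃ : Site 2 := ![K, t] with hz₃
  set tip : Site 2 := ![(K : ℤ) + 1, t] with htip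
  obtain ⟨γ₁, hs₁, hed₁⟩ := exists_vRun (z := (0 : Site 2)) (z' := z₁) (by simp [hz₁])
  obtain ⟨γ₂, hs₂, hed₂, -⟩ := exists_rightRun_to (z := z₁) (z' := z₂) (by simp [hz₁, hz₂]) (by simp [hz₁, hz₂])
  obtain ⟨γ₃, hs₃, hed₃⟩ := exists_vRun (z := z₂) (z' := z₃) (by simp [hz₂, hz₃])
  obtain ⟨γ₄, hs₄, hed₄, -⟩ := exists_rightRun_to (z := z₃) (z' := tip) (by simp [hz₃, htip]) (by simp [hz₃, htip])
  have e10 : z₁ 0 = 0 := by simp [hz₁]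
  have e11 : z₁ 1 = a := by simp [hz₁]
  have e20 : z₂ 0 = K := by simp [hz₂]
  have e21 : z₂ 1 = a := by simp [hz₂]
  have e30 : z₃ 0 = K := by simp [hz₃]
  have e31 : z₃ 1 = t := by simp [hz₃]
  have et0 : tip 0 = K + 1 := by simp [htip]
  have et1 : tip 1 = t := by simp [htip]
  have z00 : (0 : Site 2) 0 = 0 := rfl
  have z01 : (0 : Site 2) 1 = 0 := rfl
  simp only [z00, z01, e10, e11, e20, e21, e30, e31, et0] at hs₁ hed₁ hs₂ hed₂ hs₃ hed₃ hs₄ hed₄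
  refine ⟨tip, γ₁.append (γ₂.append (γ₃.append γ₄)), et0, et1, fun z hz => ?_, fun e he => ?_⟩
  · simp only [Walk.mem_support_append_iff] at hz
    rcases hz with hz | hz | hz | hz
    · have := hs₁ z hz
      left; refine ⟨this.1, ?_, ?_⟩ <;> [have := this.2.1; have := this.2.2] <;>
        simp only [min_def, max_def] at this <;> split_ifs at this <;> omega
    · have := hs₂ z hz; right; left; exact ⟨this.1, this.2.1, this.2.2⟩
    · have := hs₃ z hz
      right; right; left; refine ⟨this.1, ?_, ?_⟩ <;> [have := this.2.1; have := this.2.2] <;>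
        simp only [min_def, max_def] at this <;> split_ifs at this <;> omega
    · have := hs₄ z hz
      rcases eq_or_lt_of_le this.2.1 with h0 | h0
      · right; right; left; exact ⟨h0.symm, by omega, by omega⟩
      · right; right; right; exact ⟨by omega, this.1⟩
  · simp only [Walk.edges_append, List.mem_append] at he
    rcases he with he | he | he | he
    · obtain ⟨v, rfl, hv0, hv1, hv1'⟩ := hed₁ e he
      simp only [min_def, max_def] at hv1 hv1'
      rw [mk_add_single_one_mem_hubOpen_iff]
      left; refine ⟨hv0, ?_, ?_⟩ <;> split_ifs at hv1 hv1' <;> omega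
    · obtain ⟨v, rfl, hv1, hv0, hv0'⟩ := hed₂ e he
      rw [mk_add_single_zero_mem_hubOpen_iff]
      left; exact ⟨hv1, hv0, hv0'⟩
    · obtain ⟨v, rfl, hv0, hv1, hv1'⟩ := hed₃ e he
      simp only [min_def, max_def] at hv1 hv1'
      rw [mk_add_single_one_mem_hubOpen_iff]
      right; left; refine ⟨hv0, ?_, ?_⟩ <;> split_ifs at hv1 hv1' <;> omega
    · obtain ⟨v, rfl, hv1, hv0, hv0'⟩ := hed₄ e he
      rw [mk_add_single_zero_mem_hubOpen_iff]
      right; right; right; left; exact ⟨by omega, by omega, by omega⟩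

/-- **The hub walk to a tooth of the lower right comb**: for `-a - h ≤ t ≤ -a`, an open-comb walk
from the origin to `(K + 1, t)`. [folklore] -/
theorem exists_hubWalkRneg (K a h : ℕ) {t : ℤ} (ht : -((a : ℤ) + h) ≤ t) (ht' : t ≤ -(a : ℤ)) :
    ∃ (tip : Site 2) (U : (zdGraph 2).Walk 0 tip), tip 0 = K + 1 ∧ tip 1 = t ∧
      (∀ z ∈ U.support, (z 0 = 0 ∧ -(a : ℤ) ≤ z 1 ∧ z 1 ≤ 0) ∨ (z 1 = -(a : ℤ) ∧ 0 ≤ z 0 ∧ z 0 ≤ K) ∨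
        (z 0 = K ∧ -((a : ℤ) + h) ≤ z 1 ∧ z 1 ≤ -(a : ℤ)) ∨ (z 0 = K + 1 ∧ z 1 = t)) ∧
      ∀ e ∈ U.edges, e ∈ hubOpen K a h := by
  set z₁ : Site 2 := ![0, -(a : ℤ)] with hz₁
  set z₂ : Site 2 := ![K, -(a : ℤ)] with hz₂
  set z₃ : Site 2 := ![K, t] with hz₃
  set tip : Site 2 := ![(K : ℤ) + 1, t] with htip
  obtain ⟨γ₁, hs₁, hed₁⟩ := exists_vRun (z := (0 : Site 2)) (z' := z₁) (by simp [hz₁])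
  obtain ⟨γ₂, hs₂, hed₂, -⟩ := exists_rightRun_to (z := z₁) (z' := z₂) (by simp [hz₁, hz₂]) (by simp [hz₁, hz₂])
  obtain ⟨γ₃, hs₃, hed₃⟩ := exists_vRun (z := z₂) (z' := z₃) (by simp [hz₂, hz₃])
  obtain ⟨γ₄, hs₄, hed₄, -⟩ := exists_rightRun_to (z := z₃) (z' := tip) (by simp [hz₃, htip]) (by simp [hz₃, htip])
  have e10 : z₁ 0 = 0 := by simp [hz₁]
  have e11 : z₁ 1 = -(a : ℤ) := by simp [hz₁]
  have e20 : z₂ 0 = K := by simp [hz₂]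
  have e21 : z₂ 1 = -(a : ℤ) := by simp [hz₂]
  have e30 : z₃ 0 = K := by simp [hz₃]
  have e31 : z₃ 1 = t := by simp [hz₃]
  have et0 : tip 0 = K + 1 := by simp [htip]
  have et1 : tip 1 = t := by simp [htip]
  have z00 : (0 : Site 2) 0 = 0 := rfl
  have z01 : (0 : Site 2) 1 = 0 := rfl
  simp only [z00, z01, e10, e11, e20, e21, e30, e31, et0] at hs₁ hed₁ hs₂ hed₂ hs₃ hed₃ hs₄ hed₄
  refine ⟨tip, γ₁.append (γ₂.append (γ₃.append γ₄)), et0, et1, fun z hz => ?_, fun e he => ?_⟩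
  · simp only [Walk.mem_support_append_iff] at hz
    rcases hz with hz | hz | hz | hz
    · have := hs₁ z hz
      left; refine ⟨this.1, ?_, ?_⟩ <;> [have := this.2.1; have := this.2.2] <;>
        simp only [min_def, max_def] at this <;> split_ifs at this <;> omega
    · have := hs₂ z hz; right; left; exact ⟨this.1, this.2.1, this.2.2⟩
    · have := hs₃ z hz
      right; right; left; refine ⟨this.1, ?_, ?_⟩ <;> [have := this.2.1; have := this.2.2] <;>
        simp only [min_def, max_def] at this <;> split_ifs at this <;> omega
    · have := hs₄ z hz
      rcases eq_or_lt_of_le this.2.1 with h0 | h0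
      · right; right; left; exact ⟨h0.symm, by omega, by omega⟩
      · right; right; right; exact ⟨by omega, this.1⟩
  · simp only [Walk.edges_append, List.mem_append] at he
    rcases he with he | he | he | he
    · obtain ⟨v, rfl, hv0, hv1, hv1'⟩ := hed₁ e he
      simp only [min_def, max_def] at hv1 hv1'
      rw [mk_add_single_one_mem_hubOpen_iff]
      left; refine ⟨hv0, ?_, ?_⟩ <;> split_ifs at hv1 hv1' <;> omega
    · obtain ⟨v, rfl, hv1, hv0, hv0'⟩ := hed₂ e he
      rw [mk_add_single_zero_mem_hubOpen_iff]
      right; left; exact ⟨hv1, hv0, hv0'⟩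
    · obtain ⟨v, rfl, hv0, hv1, hv1'⟩ := hed₃ e he
      simp only [min_def, max_def] at hv1 hv1'
      rw [mk_add_single_one_mem_hubOpen_iff]
      right; right; left; refine ⟨hv0, ?_, ?_⟩ <;> split_ifs at hv1 hv1' <;> omega
    · obtain ⟨v, rfl, hv1, hv0, hv0'⟩ := hed₄ e he
      rw [mk_add_single_zero_mem_hubOpen_iff]
      right; right; right; right; left; exact ⟨by omega, by omega, by omega⟩

/-- **The hub walk to a tooth of the left comb**: for `0 ≤ t ≤ h`, an open-comb walk from the
origin to `(-K - 1, t)` — along the row `0` to `(-K, 0)`, up the tooth column, one step left.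
[folklore] -/
theorem exists_hubWalkL (K a h : ℕ) {t : ℤ} (ht : 0 ≤ t) (ht' : t ≤ h) :
    ∃ (tip : Site 2) (U : (zdGraph 2).Walk 0 tip), tip 0 = -(K : ℤ) - 1 ∧ tip 1 = t ∧
      (∀ z ∈ U.support, (z 1 = 0 ∧ -(K : ℤ) ≤ z 0 ∧ z 0 ≤ 0) ∨ (z 0 = -(K : ℤ) ∧ 0 ≤ z 1 ∧ z 1 ≤ h) ∨
        (z 0 = -(K : ℤ) - 1 ∧ z 1 = t)) ∧
      ∀ e ∈ U.edges, e ∈ hubOpen K a h := by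
  set z₁ : Site 2 := ![-(K : ℤ), 0] with hz₁
  set z₂ : Site 2 := ![-(K : ℤ), t] with hz₂
  set tip : Site 2 := ![-(K : ℤ) - 1, t] with htip
  obtain ⟨γ₁, hs₁, hed₁, -⟩ := exists_rightRun_to (z := z₁) (z' := (0 : Site 2)) (by simp [hz₁]) (by simp [hz₁])
  obtain ⟨γ₂, hs₂, hed₂⟩ := exists_vRun (z := z₁) (z' := z₂) (by simp [hz₁, hz₂])
  obtain ⟨γ₃, hs₃, hed₃, -⟩ := exists_rightRun_to (z := tip) (z' := z₂) (by simp [hz₂, htip]) (by simp [hz₂, htip])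
  have e10 : z₁ 0 = -(K : ℤ) := by simp [hz₁]
  have e11 : z₁ 1 = 0 := by simp [hz₁]
  have e20 : z₂ 0 = -(K : ℤ) := by simp [hz₂]
  have e21 : z₂ 1 = t := by simp [hz₂]
  have et0 : tip 0 = -(K : ℤ) - 1 := by simp [htip]
  have et1 : tip 1 = t := by simp [htip]
  have z00 : (0 : Site 2) 0 = 0 := rfl
  have z01 : (0 : Site 2) 1 = 0 := rfl
  simp only [z00, e10, e11, e20, e21, et0, et1] at hs₁ hed₁ hs₂ hed₂ hs₃ hed₃
  refine ⟨tip, γ₁.reverse.append (γ₂.append γ₃.reverse), et0, et1, fun z hz => ?_, fun e he => ?_⟩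
  · simp only [Walk.mem_support_append_iff, Walk.support_reverse, List.mem_reverse] at hz
    rcases hz with hz | hz | hz
    · have := hs₁ z hz; left; exact ⟨this.1, this.2.1, this.2.2⟩
    · have := hs₂ z hz
      right; left; refine ⟨this.1, ?_, ?_⟩ <;> [have := this.2.1; have := this.2.2] <;>
        simp only [min_def, max_def] at this <;> split_ifs at this <;> omega
    · have := hs₃ z hz
      rcases eq_or_lt_of_le this.2.2 with h0 | h0
      · right; left; exact ⟨h0, by omega, by omega⟩
      · right; right; exact ⟨by omega, this.1⟩
  · simp only [Walk.edges_append, List.mem_append, Walk.edges_reverse, List.mem_reverse] at he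
    rcases he with he | he | he
    · obtain ⟨v, rfl, hv1, hv0, hv0'⟩ := hed₁ e he
      rw [mk_add_single_zero_mem_hubOpen_iff]
      right; right; left; exact ⟨hv1, hv0, hv0'⟩
    · obtain ⟨v, rfl, hv0, hv1, hv1'⟩ := hed₂ e he
      simp only [min_def, max_def] at hv1 hv1'
      rw [mk_add_single_one_mem_hubOpen_iff]
      right; right; right; refine ⟨hv0, ?_, ?_⟩ <;> split_ifs at hv1 hv1' <;> omega
    · obtain ⟨v, rfl, hv1, hv0, hv0'⟩ := hed₃ e he
      rw [mk_add_single_zero_mem_hubOpen_iff]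
      right; right; right; right; right; exact ⟨by omega, by omega, by omega⟩

/-- The edge crossed by a dart whose edge is the horizontal unit edge `{v, v + e₀}` is the
vertical edge `{v + e₀, v + e₀ + e₁}` (right side of the face `v`). [folklore] -/
theorem sepEdge_eq_of_edge_eq_right {d : (zdGraph 2).Dart} {v : Site 2}
    (h : d.edge = s(v, v + Pi.single 0 1)) :
    sepEdge d.fst d.snd = s(v + Pi.single 0 1, v + Pi.single 0 1 + Pi.single 1 1) := by
  have h' : s(d.fst, d.snd) = s(v, v + Pi.single 0 1) := h
  rcases Sym2.eq_iff.1 h' with ⟨h1, h2⟩ | ⟨h1, h2⟩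
  · rw [h1, h2, sepEdge_right]
  · rw [h1, h2, sepEdge_comm, sepEdge_right]

/-- The edge crossed by a dart whose edge is the vertical unit edge `{v, v + e₁}` is the
horizontal edge `{v + e₁, v + e₁ + e₀}` (top side of the face `v`). [folklore] -/
theorem sepEdge_eq_of_edge_eq_up {d : (zdGraph 2).Dart} {v : Site 2}
    (h : d.edge = s(v, v + Pi.single 1 1)) :
    sepEdge d.fst d.snd = s(v + Pi.single 1 1, v + Pi.single 1 1 + Pi.single 0 1) := by
  have h' : s(d.fst, d.snd) = s(v, v + Pi.single 1 1) := h
  rcases Sym2.eq_iff.1 h' with ⟨h1, h2⟩ | ⟨h1, h2⟩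
  · rw [h1, h2, sepEdge_up]
  · rw [h1, h2, sepEdge_comm, sepEdge_up]

/-- A predicate of the crossed edge holds along the reversed face walk if it holds along the
walk. [folklore] -/
theorem sepEdge_forall_darts_reverse {x y : Site 2} {P : Sym2 (Site 2) → Prop} {p : (zdGraph 2).Walk x y}
    (hp : ∀ d ∈ p.darts, P (sepEdge d.fst d.snd)) : ∀ d ∈ p.reverse.darts, P (sepEdge d.fst d.snd) := by
  intro d hd
  rw [Walk.darts_reverse, List.mem_reverse, List.mem_map] at hd
  obtain ⟨d', hd', rfl⟩ := hd
  rw [sepEdge_dart_symm]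
  exact hp d' hd'

/-- The edge of a dart of a walk is an edge of the walk. [folklore] -/
theorem dart_edge_mem_edges {V : Type*} {G : SimpleGraph V} {x y : V} (p : G.Walk x y) {d : G.Dart}
    (hd : d ∈ p.darts) : d.edge ∈ p.edges := by
  rw [Walk.edges]; exact List.mem_map.2 ⟨d, hd, rfl⟩

/-- **The dual path through the hub, top half.** For `0 ≤ b ≤ h` (`a + 1 ≤ K`, `h + 1 ≤ K`), a
walk of faces from the face `(b, K)` (just below the bottom face of the top inner dual corridor)
to the face `(-1, 0)` north-west of the origin: along the face row `K` to the column `-1`, then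
down that column.  Every step crosses a forced pair of the hub which is not in the open comb
(hence a closed edge, on the hub event). [folklore] -/
theorem exists_hubDualPathT (K a h : ℕ) (haK : (a : ℤ) + 1 ≤ K) (hhK : (h : ℤ) + 1 ≤ K) {b : ℤ}
    (hb : 0 ≤ b) (hb' : b ≤ h) :
    ∃ (fT : Site 2) (U : (zdGraph 2).Walk fT ![-1, 0]), fT 0 = b ∧ fT 1 = K ∧
      (∀ z ∈ U.support, -1 ≤ z 0 ∧ z 0 ≤ h ∧ 0 ≤ z 1 ∧ z 1 ≤ K) ∧
      ∀ d ∈ U.darts, sepEdge d.fst d.snd ∈ hubPairs K ∧ sepEdge d.fst d.snd ∉ hubOpen K a h := by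
  set fT : Site 2 := ![b, K] with hfT
  set cT : Site 2 := ![-1, K] with hcT
  set NW : Site 2 := ![-1, 0] with hNW
  have efT0 : fT 0 = b := by simp [hfT]
  have efT1 : fT 1 = K := by simp [hfT]
  have ecT0 : cT 0 = -1 := by simp [hcT]
  have ecT1 : cT 1 = K := by simp [hcT]
  have eNW0 : NW 0 = -1 := by simp [hNW]
  have eNW1 : NW 1 = 0 := by simp [hNW]
  obtain ⟨ρ₁, hs₁, hed₁, -⟩ := exists_rightRun_to (z := cT) (z' := fT) (by rw [efT1, ecT1]) (by rw [ecT0, efT0]; omega)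
  obtain ⟨ρ₂, hs₂, hed₂⟩ := exists_vRun (z := cT) (z' := NW) (by rw [eNW0, ecT0])
  simp only [efT0, ecT0, ecT1, eNW1] at hs₁ hed₁ hs₂ hed₂
  have box_of : ∀ w : Site 2, -(K : ℤ) ≤ w 0 → w 0 ≤ K → -(K : ℤ) ≤ w 1 → w 1 ≤ K → w ∈ box 2 K := by
    intro w h1 h2 h3 h4; rw [mem_box, Fin.forall_fin_two]; exact ⟨⟨h1, h2⟩, h3, h4⟩
  have H₁ : ∀ d ∈ ρ₁.darts, sepEdge d.fst d.snd ∈ hubPairs K ∧ sepEdge d.fst d.snd ∉ hubOpen K a h := by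
    intro d hd
    obtain ⟨v, hv, hv1, hv0, hv0'⟩ := hed₁ _ (dart_edge_mem_edges ρ₁ hd)
    rw [sepEdge_eq_of_edge_eq_right hv]
    refine ⟨mem_hubPairs_of_adj (adj_of_stepKind (.up (by simp) (by simp))) (Or.inl (box_of _ ?_ ?_ ?_ ?_)), ?_⟩
    · simp only [Pi.add_apply, single_zero_apply_zero]; omega
    · simp only [Pi.add_apply, single_zero_apply_zero]; omega
    · simp only [Pi.add_apply, single_zero_apply_one, add_zero]; omega
    · simp only [Pi.add_apply, single_zero_apply_one, add_zero]; omega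
    · rw [mk_add_single_one_mem_hubOpen_iff]
      simp only [Pi.add_apply, single_zero_apply_zero, single_zero_apply_one, add_zero]
      omega
  have H₂ : ∀ d ∈ ρ₂.darts, sepEdge d.fst d.snd ∈ hubPairs K ∧ sepEdge d.fst d.snd ∉ hubOpen K a h := by
    intro d hd
    obtain ⟨v, hv, hv0, hv1, hv1'⟩ := hed₂ _ (dart_edge_mem_edges ρ₂ hd)
    simp only [min_def, max_def] at hv1 hv1'
    rw [sepEdge_eq_of_edge_eq_up hv]
    refine ⟨mem_hubPairs_of_adj (adj_of_stepKind (.right (by simp) (by simp))) (Or.inr (box_of _ ?_ ?_ ?_ ?_)), ?_⟩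
    · simp only [Pi.add_apply, single_one_apply_zero, single_zero_apply_zero, add_zero]; omega
    · simp only [Pi.add_apply, single_one_apply_zero, single_zero_apply_zero, add_zero]; omega
    · simp only [Pi.add_apply, single_one_apply_one, single_zero_apply_one, add_zero]; split_ifs at hv1 hv1' <;> omega
    · simp only [Pi.add_apply, single_one_apply_one, single_zero_apply_one, add_zero]; split_ifs at hv1 hv1' <;> omega
    · rw [mk_add_single_zero_mem_hubOpen_iff]
      simp only [Pi.add_apply, single_one_apply_zero, single_one_apply_one, add_zero]
      split_ifs at hv1 hv1' <;> omega
  refine ⟨fT, ρ₁.reverse.append ρ₂, efT0, efT1, fun z hz => ?_, fun d hd => ?_⟩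
  · rw [Walk.mem_support_append_iff, Walk.support_reverse, List.mem_reverse] at hz
    rcases hz with hz | hz
    · have := hs₁ z hz; omega
    · have := hs₂ z hz; simp only [min_def, max_def] at this; split_ifs at this <;> omega
  · rw [Walk.darts_append, List.mem_append] at hd
    rcases hd with hd | hd
    · exact sepEdge_forall_darts_reverse (P := fun e => e ∈ hubPairs K ∧ e ∉ hubOpen K a h) H₁ d hd
    · exact H₂ d hd

/-- **The dual path through the hub, bottom half**: from the face `(-1, -1)` south-west of the
origin down the column `-1` to the face row `-K-1` and along it to the face `(b, -K-1)` (just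
above the top face of the bottom inner dual corridor), across forced non-comb pairs. [folklore] -/
theorem exists_hubDualPathB (K a h : ℕ) (haK : (a : ℤ) + 1 ≤ K) (hhK : (h : ℤ) + 1 ≤ K) {b : ℤ}
    (hb : 0 ≤ b) (hb' : b ≤ h) :
    ∃ (fB : Site 2) (U : (zdGraph 2).Walk ![-1, -1] fB), fB 0 = b ∧ fB 1 = -(K : ℤ) - 1 ∧
      (∀ z ∈ U.support, -1 ≤ z 0 ∧ z 0 ≤ h ∧ -(K : ℤ) - 1 ≤ z 1 ∧ z 1 ≤ -1) ∧
      ∀ d ∈ U.darts, sepEdge d.fst d.snd ∈ hubPairs K ∧ sepEdge d.fst d.snd ∉ hubOpen K a h := by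
  set fB : Site 2 := ![b, -(K : ℤ) - 1] with hfB
  set cB : Site 2 := ![-1, -(K : ℤ) - 1] with hcB
  set SW : Site 2 := ![-1, -1] with hSW
  have efB0 : fB 0 = b := by simp [hfB]
  have efB1 : fB 1 = -(K : ℤ) - 1 := by simp [hfB]
  have ecB0 : cB 0 = -1 := by simp [hcB]
  have ecB1 : cB 1 = -(K : ℤ) - 1 := by simp [hcB]
  have eSW0 : SW 0 = -1 := by simp [hSW]
  have eSW1 : SW 1 = -1 := by simp [hSW]
  obtain ⟨ρ₃, hs₃, hed₃⟩ := exists_vRun (z := SW) (z' := cB) (by rw [ecB0, eSW0])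
  obtain ⟨ρ₄, hs₄, hed₄, -⟩ := exists_rightRun_to (z := cB) (z' := fB) (by rw [efB1, ecB1]) (by rw [ecB0, efB0]; omega)
  simp only [efB0, ecB0, ecB1, eSW0, eSW1] at hs₃ hed₃ hs₄ hed₄
  have box_of : ∀ w : Site 2, -(K : ℤ) ≤ w 0 → w 0 ≤ K → -(K : ℤ) ≤ w 1 → w 1 ≤ K → w ∈ box 2 K := by
    intro w h1 h2 h3 h4; rw [mem_box, Fin.forall_fin_two]; exact ⟨⟨h1, h2⟩, h3, h4⟩
  have H₃ : ∀ d ∈ ρ₃.darts, sepEdge d.fst d.snd ∈ hubPairs K ∧ sepEdge d.fst d.snd ∉ hubOpen K a h := by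
    intro d hd
    obtain ⟨v, hv, hv0, hv1, hv1'⟩ := hed₃ _ (dart_edge_mem_edges ρ₃ hd)
    simp only [min_def, max_def] at hv1 hv1'
    rw [sepEdge_eq_of_edge_eq_up hv]
    refine ⟨mem_hubPairs_of_adj (adj_of_stepKind (.right (by simp) (by simp))) (Or.inr (box_of _ ?_ ?_ ?_ ?_)), ?_⟩
    · simp only [Pi.add_apply, single_one_apply_zero, single_zero_apply_zero, add_zero]; omega
    · simp only [Pi.add_apply, single_one_apply_zero, single_zero_apply_zero, add_zero]; omega
    · simp only [Pi.add_apply, single_one_apply_one, single_zero_apply_one, add_zero]; split_ifs at hv1 hv1' <;> omega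
    · simp only [Pi.add_apply, single_one_apply_one, single_zero_apply_one, add_zero]; split_ifs at hv1 hv1' <;> omega
    · rw [mk_add_single_zero_mem_hubOpen_iff]
      simp only [Pi.add_apply, single_one_apply_zero, single_one_apply_one, add_zero]
      split_ifs at hv1 hv1' <;> omega
  have H₄ : ∀ d ∈ ρ₄.darts, sepEdge d.fst d.snd ∈ hubPairs K ∧ sepEdge d.fst d.snd ∉ hubOpen K a h := by
    intro d hd
    obtain ⟨v, hv, hv1, hv0, hv0'⟩ := hed₄ _ (dart_edge_mem_edges ρ₄ hd)
    rw [sepEdge_eq_of_edge_eq_right hv]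
    refine ⟨mem_hubPairs_of_adj (adj_of_stepKind (.up (by simp) (by simp))) (Or.inr (box_of _ ?_ ?_ ?_ ?_)), ?_⟩
    · simp only [Pi.add_apply, single_zero_apply_zero, single_one_apply_zero, add_zero]; omega
    · simp only [Pi.add_apply, single_zero_apply_zero, single_one_apply_zero, add_zero]; omega
    · simp only [Pi.add_apply, single_zero_apply_one, single_one_apply_one, add_zero]; omega
    · simp only [Pi.add_apply, single_zero_apply_one, single_one_apply_one, add_zero]; omega
    · rw [mk_add_single_one_mem_hubOpen_iff]
      simp only [Pi.add_apply, single_zero_apply_zero, single_zero_apply_one, add_zero]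
      omega
  refine ⟨fB, ρ₃.append ρ₄, efB0, efB1, fun z hz => ?_, fun d hd => ?_⟩
  · rw [Walk.mem_support_append_iff] at hz
    rcases hz with hz | hz
    · have := hs₃ z hz; simp only [min_def, max_def] at this; split_ifs at this <;> omega
    · have := hs₄ z hz; omega
  · rw [Walk.darts_append, List.mem_append] at hd
    rcases hd with hd | hd
    · exact H₃ d hd
    · exact H₄ d hd

/-- The open comb consists of forced pairs (when `a + h ≤ K`). [folklore] -/
theorem hubOpen_subset_hubPairs {K a h : ℕ} (hK : a + h ≤ K) : hubOpen K a h ⊆ ↑(hubPairs K) := by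
  have box_of : ∀ w : Site 2, -(K : ℤ) ≤ w 0 → w 0 ≤ K → -(K : ℤ) ≤ w 1 → w 1 ≤ K → w ∈ box 2 K := by
    intro w h1 h2 h3 h4; rw [mem_box, Fin.forall_fin_two]; exact ⟨⟨h1, h2⟩, h3, h4⟩
  rintro e (⟨v, rfl, hc⟩ | ⟨v, rfl, hc⟩) <;> rw [Finset.mem_coe]
  · refine mem_hubPairs_of_adj (adj_of_stepKind (.up (by simp) (by simp))) (Or.inl (box_of _ ?_ ?_ ?_ ?_)) <;> omega
  · rcases hc with hc | hc | hc | hc | hc | hc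
    · refine mem_hubPairs_of_adj (adj_of_stepKind (.right (by simp) (by simp))) (Or.inl (box_of _ ?_ ?_ ?_ ?_)) <;> omega
    · refine mem_hubPairs_of_adj (adj_of_stepKind (.right (by simp) (by simp))) (Or.inl (box_of _ ?_ ?_ ?_ ?_)) <;> omega
    · refine mem_hubPairs_of_adj (adj_of_stepKind (.right (by simp) (by simp))) (Or.inr (box_of _ ?_ ?_ ?_ ?_)) <;>
        simp only [Pi.add_apply, single_zero_apply_zero, single_zero_apply_one, add_zero] <;> omega
    · refine mem_hubPairs_of_adj (adj_of_stepKind (.right (by simp) (by simp))) (Or.inl (box_of _ ?_ ?_ ?_ ?_)) <;> omega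
    · refine mem_hubPairs_of_adj (adj_of_stepKind (.right (by simp) (by simp))) (Or.inl (box_of _ ?_ ?_ ?_ ?_)) <;> omega
    · refine mem_hubPairs_of_adj (adj_of_stepKind (.right (by simp) (by simp))) (Or.inr (box_of _ ?_ ?_ ?_ ?_)) <;>
        simp only [Pi.add_apply, single_zero_apply_zero, single_zero_apply_one, add_zero] <;> omega

/-- On the hub event, comb pairs are open. [folklore] -/
theorem mem_of_mem_zdHub_of_mem_hubOpen {K a h : ℕ} (hK : a + h ≤ K) {ω : BondConfig (Site 2)}
    (hω : ω ∈ zdHub K a h) {e : Sym2 (Site 2)} (he : e ∈ hubOpen K a h) : e ∈ ω :=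
  (hω e (hubOpen_subset_hubPairs hK he)).2 he

end HubPaths

/-! ### Dual corridor events in face-walk form -/

section DualCorridor

/-- **A closed-dual top–bottom crossing of the translated dual rectangle** `u + ([0, m-1] × [-1, n'])`
(faces), in face-walk form: a walk of faces from the top row `{f₁ = u₁ + n'}` to the bottom row
`{f₁ = u₁ - 1}` inside the rectangle, every step of which crosses a closed primal edge — the form
delivered by `exists_faceWalk_of_mem_dualTBCrossingAt`. [cite: BollobasRiordan2006, Ch. 3 Lemma 1] -/
def dualFaceCrossing (u : Site 2) (m n' : ℕ) : Set (BondConfig (Site 2)) :=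
  {ω | ∃ (a b : Site 2) (W : (zdGraph 2).Walk a b), a 1 = u 1 + n' ∧ b 1 = u 1 - 1 ∧
      (∀ f ∈ W.support, u 0 ≤ f 0 ∧ f 0 + 1 ≤ u 0 + m ∧ u 1 - 1 ≤ f 1 ∧ f 1 ≤ u 1 + n') ∧
      ∀ d ∈ W.darts, sepEdge d.fst d.snd ∉ ω}

/-- The dual crossing event of `Crossings.lean` is contained in its face-walk form. [folklore] -/
theorem dualTBCrossingAt_subset_dualFaceCrossing (u : Site 2) (m n' : ℕ) :
    dualTBCrossingAt u m n' ⊆ dualFaceCrossing u m n' := fun _ hω =>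
  let ⟨a, b, W, ha, hb, hs, hd⟩ := exists_faceWalk_of_mem_dualTBCrossingAt hω
  ⟨a, b, W, ha, hb, hs, hd⟩

/-- The face-walk dual crossing event is decreasing. [folklore] -/
theorem isLowerSet_dualFaceCrossing (u : Site 2) (m n' : ℕ) : IsLowerSet (dualFaceCrossing u m n') := by
  rintro ω ω' hle ⟨a, b, W, ha, hb, hs, hd⟩
  exact ⟨a, b, W, ha, hb, hs, fun d hd' he => hd d hd' (hle he)⟩

/-- The primal pairs read by `dualFaceCrossing u m n'`: pairs of sites of the box
`[u₀, u₀ + m] × [u₁ - 1, u₁ + n' + 1]` (it contains both endpoints of every edge crossed by a step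
between two faces of the dual rectangle). [folklore] -/
def dualFaceCrossingPairs (u : Site 2) (m n' : ℕ) : Finset (Sym2 (Site 2)) :=
  (Finset.Icc ![u 0, u 1 - 1] ![u 0 + m, u 1 + n' + 1]).sym2

/-- Coordinates of the sites of `dualFaceCrossingPairs`. [folklore] -/
theorem mem_Icc_dualFace_iff {u x : Site 2} {m n' : ℕ} :
    x ∈ Finset.Icc ![u 0, u 1 - 1] ![u 0 + m, u 1 + n' + 1] ↔
      u 0 ≤ x 0 ∧ x 0 ≤ u 0 + m ∧ u 1 - 1 ≤ x 1 ∧ x 1 ≤ u 1 + n' + 1 := by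
  simp only [Finset.mem_Icc, Pi.le_def, Fin.forall_fin_two, Matrix.cons_val_zero, Matrix.cons_val_one]
  tauto

/-- The edge crossed by a step between two faces of the dual rectangle is a pair of
`dualFaceCrossingPairs`. [folklore] -/
theorem sepEdge_mem_dualFaceCrossingPairs {u z z' : Site 2} {m n' : ℕ}
    (hz : u 0 ≤ z 0 ∧ z 0 + 1 ≤ u 0 + m ∧ u 1 - 1 ≤ z 1 ∧ z 1 ≤ u 1 + n')
    (hz' : u 0 ≤ z' 0 ∧ z' 0 + 1 ≤ u 0 + m ∧ u 1 - 1 ≤ z' 1 ∧ z' 1 ≤ u 1 + n') :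
    sepEdge z z' ∈ dualFaceCrossingPairs u m n' := by
  rw [dualFaceCrossingPairs, Finset.mem_sym2_iff]
  intro x hx
  rw [mem_Icc_dualFace_iff]
  obtain ⟨⟨h0, h0'⟩, ⟨h1, h1'⟩⟩ := sepEdge_apply_le hx
  refine ⟨?_, ?_, ?_, ?_⟩
  · have : u 0 ≤ max (z 0) (z' 0) := le_max_of_le_left hz.1; omega
  · have : max (z 0) (z' 0) + 1 ≤ u 0 + m := by
      rcases le_total (z 0) (z' 0) with hle | hle <;> simp [hle] <;> omega
    omega
  · have : u 1 - 1 ≤ max (z 1) (z' 1) := le_max_of_le_left hz.2.2.1; omega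
  · have : max (z 1) (z' 1) ≤ u 1 + n' := max_le hz.2.2.2 hz'.2.2.2; omega

/-- **`dualFaceCrossing u m n'` is determined by `dualFaceCrossingPairs u m n'`.** [folklore] -/
theorem determinedBy_dualFaceCrossing (u : Site 2) (m n' : ℕ) :
    DeterminedBy (dualFaceCrossing u m n') ↑(dualFaceCrossingPairs u m n') := by
  suffices key : ∀ ω ω' : BondConfig (Site 2), ω ∩ ↑(dualFaceCrossingPairs u m n') = ω' ∩ ↑(dualFaceCrossingPairs u m n') →
      ω' ∈ dualFaceCrossing u m n' → ω ∈ dualFaceCrossing u m n' by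
    rw [determinedBy_iff]
    exact fun ω ω' h => ⟨key ω' ω h.symm, key ω ω' h⟩
  rintro ω ω' h ⟨a, b, W, ha, hb, hs, hd⟩
  refine ⟨a, b, W, ha, hb, hs, fun d hd' he => hd d hd' (mem_of_inter_eq h ?_ he)⟩
  exact sepEdge_mem_dualFaceCrossingPairs (hs _ (W.dart_fst_mem_support_of_mem_darts hd'))
    (hs _ (W.dart_snd_mem_support_of_mem_darts hd'))

/-- The face-walk dual crossing event is measurable. [folklore] -/
theorem measurableSet_dualFaceCrossing (u : Site 2) (m n' : ℕ) : MeasurableSet (dualFaceCrossing u m n') :=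
  (determinedBy_dualFaceCrossing u m n').measurableSet_of_finset

/-- **RSW for the face-walk dual crossing**: `P_{1/2}(dualFaceCrossing u (m+1) n) ≥ crossingProb ½ (n+1) m`
(the dual crossing has the probability of the primal crossing of the transposed rectangle at the
dual parameter, `real_dualTBCrossing_succ`, and `1 - 1/2 = 1/2`). [cite: BollobasRiordan2006, Ch. 3, Corollary 3(i)] -/
theorem crossingProb_le_real_dualFaceCrossing (u : Site 2) (m n : ℕ) :
    crossingProb half (n + 1) m ≤ (bondPercolation (zdGraph 2) half).real (dualFaceCrossing u (m + 1) n) := by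
  have := real_dualTBCrossingAt half u (m + 1) n
  rw [real_dualTBCrossing_succ, symm_half] at this
  rw [← this]
  exact measureReal_mono (dualTBCrossingAt_subset_dualFaceCrossing u (m + 1) n)

/-- **The row of horizontal edges** `{(c, r), (c+1, r)}`, `c₀ ≤ c ≤ c₀ + w`. [folklore] -/
def rowEdges (c₀ r : ℤ) (w : ℕ) : Finset (Sym2 (Site 2)) :=
  (Finset.range (w + 1)).image fun i : ℕ => s((![c₀ + i, r] : Site 2), ![c₀ + i + 1, r])

/-- Membership of a row edge in `rowEdges`. [folklore] -/
theorem mk_mem_rowEdges {c₀ r : ℤ} {w : ℕ} {c : ℤ} (hc : c₀ ≤ c) (hc' : c ≤ c₀ + w) :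
    s((![c, r] : Site 2), ![c + 1, r]) ∈ rowEdges c₀ r w := by
  rw [rowEdges, Finset.mem_image]
  refine ⟨(c - c₀).toNat, Finset.mem_range.2 (by omega), ?_⟩
  have : (c₀ : ℤ) + ((c - c₀).toNat : ℕ) = c := by rw [Int.toNat_of_nonneg (by omega)]; ring
  rw [this]

/-- **The row-closed event**: every edge of the row is closed (decreasing, determined by the row,
probability `≥ 2^{-(w+1)}` at `p = 1/2`). [folklore] -/
def rowClosed (c₀ r : ℤ) (w : ℕ) : Set (BondConfig (Site 2)) :=
  {ω | ∀ e ∈ rowEdges c₀ r w, e ∉ ω}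

/-- The row-closed event is decreasing. [folklore] -/
theorem isLowerSet_rowClosed (c₀ r : ℤ) (w : ℕ) : IsLowerSet (rowClosed c₀ r w) :=
  fun _ _ hle h e he he' => h e he (hle he')

/-- The row-closed event has probability at least `(1/2)^{w+1}` at `p = 1/2`. [folklore] -/
theorem le_real_rowClosed (c₀ r : ℤ) (w : ℕ) :
    (1 / 2 : ℝ) ^ (w + 1) ≤ (bondPercolation (zdGraph 2) half).real (rowClosed c₀ r w) := by
  have h := le_bondPercolation_real_forall_notMem (zdGraph 2) half (rowEdges c₀ r w)
  rw [coe_half, show (1 : ℝ) - 1 / 2 = 1 / 2 by norm_num] at h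
  refine le_trans (pow_le_pow_of_le_one (by norm_num) (by norm_num) ?_) h
  rw [rowEdges]
  exact Finset.card_image_le.trans (by simp)

end DualCorridor

/-! ### The extension events for the point bound `(U)`: corridors and their pair sets -/

section UEvents

/-- Sites of a pair of `((rectangle M n).image (· + u)).sym2` lie in the translated rectangle.
[folklore] -/
theorem apply_le_of_mem_rectanglePairs {u : Site 2} {M n : ℕ} {e : Sym2 (Site 2)}
    (he : e ∈ ((rectangle M n).image (· + u)).sym2) {x : Site 2} (hx : x ∈ e) :
    u 0 ≤ x 0 ∧ x 0 ≤ u 0 + M ∧ u 1 ≤ x 1 ∧ x 1 ≤ u 1 + n := by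
  have := Finset.mem_sym2_iff.1 he x hx
  rw [← Finset.mem_coe, Finset.coe_image] at this
  exact mem_image_rectangle_iff.1 this

/-- Sites of a pair of `dualFaceCrossingPairs u m n'`. [folklore] -/
theorem apply_le_of_mem_dualFaceCrossingPairs {u : Site 2} {m n' : ℕ} {e : Sym2 (Site 2)}
    (he : e ∈ dualFaceCrossingPairs u m n') {x : Site 2} (hx : x ∈ e) :
    u 0 ≤ x 0 ∧ x 0 ≤ u 0 + m ∧ u 1 - 1 ≤ x 1 ∧ x 1 ≤ u 1 + n' + 1 :=
  mem_Icc_dualFace_iff.1 (Finset.mem_sym2_iff.1 he x hx)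

/-- Sites of a row edge. [folklore] -/
theorem apply_le_of_mem_rowEdges {c₀ r : ℤ} {w : ℕ} {e : Sym2 (Site 2)} (he : e ∈ rowEdges c₀ r w)
    {x : Site 2} (hx : x ∈ e) : c₀ ≤ x 0 ∧ x 0 ≤ c₀ + w + 1 ∧ x 1 = r := by
  rw [rowEdges, Finset.mem_image] at he
  obtain ⟨i, hi, rfl⟩ := he
  rw [Finset.mem_range] at hi
  rcases Sym2.mem_iff.1 hx with rfl | rfl <;> simp <;> omega

variable (k N WL ER SB NT : ℕ)

/-- **The six open corridors of `(U)`** (hub frame): outside the outer fence boxes, the bands of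
the landing intervals of the three open arms run to the right side `{x₀ = ER}` (upper and lower
right arms) and to the left side `{x₀ = -WL}` (left arm) of the target rectangle; inside the inner
fence boxes they run to the tooth columns `{x₀ = ±k/2}` of the hub. [cite: Nolin2008, §4.3, Prop. 12 and Fig. 4.7] -/
def uCorrOpen : Set (BondConfig (Site 2)) :=
  (lrCrossingAt ![(N : ℤ) + 1, (N / 4 : ℕ)] (ER - N - 1) (N / 64) ∩
    lrCrossingAt ![(N : ℤ) + 1, -((N / 4 : ℕ) + (N / 64 : ℕ) : ℤ)] (ER - N - 1) (N / 64) ∩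
    lrCrossingAt ![-(WL : ℤ), 0] (WL - N - 1) (N / 64)) ∩
  (lrCrossingAt ![((k / 2 : ℕ) : ℤ), (k / 4 : ℕ)] (k - 1 - k / 2) (k / 64) ∩
    lrCrossingAt ![((k / 2 : ℕ) : ℤ), -((k / 4 : ℕ) + (k / 64 : ℕ) : ℤ)] (k - 1 - k / 2) (k / 64) ∩
    lrCrossingAt ![-(k : ℤ) + 1, 0] (k - 1 - k / 2) (k / 64))

/-- **The four dual corridors of `(U)`** with the two closed rows joining the inner ones to the
hub: closed-dual crossings of the column band `[0, N/64]` from the top side (face row `NT`) down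
to the outer top fence box and from the outer bottom fence box down to the bottom side (face row
`-SB-1`); inside, from the inner fence boxes to the face rows `±k/2` next to the hub, plus the
rows of edges `{(c, ±k/2), (c+1, ±k/2)}`, `0 ≤ c ≤ k/64`, closed. [cite: Nolin2008, §4.3, Prop. 12 and Fig. 4.7] -/
def uCorrDual : Set (BondConfig (Site 2)) :=
  (dualFaceCrossing ![0, (N : ℤ) + 2] (N / 64 + 1) (NT - N - 2) ∩
    dualFaceCrossing ![0, -(SB : ℤ)] (N / 64 + 1) (SB - N - 2)) ∩
  ((dualFaceCrossing ![0, ((k / 2 : ℕ) : ℤ) + 1] (k / 64 + 1) (k - 3 - k / 2) ∩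
      rowClosed 0 ((k / 2 : ℕ) : ℤ) (k / 64)) ∩
    (dualFaceCrossing ![0, -(k : ℤ) + 2] (k / 64 + 1) (k - 3 - k / 2) ∩
      rowClosed 0 (-((k / 2 : ℕ) : ℤ)) (k / 64)))

/-- The pairs read by the open corridors. [folklore] -/
def uPairsP : Finset (Sym2 (Site 2)) :=
  (((rectangle (ER - N - 1) (N / 64)).image (· + (![(N : ℤ) + 1, (N / 4 : ℕ)] : Site 2))).sym2 ∪
    ((rectangle (ER - N - 1) (N / 64)).image (· + (![(N : ℤ) + 1, -((N / 4 : ℕ) + (N / 64 : ℕ) : ℤ)] : Site 2))).sym2 ∪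
    ((rectangle (WL - N - 1) (N / 64)).image (· + (![-(WL : ℤ), 0] : Site 2))).sym2) ∪
  (((rectangle (k - 1 - k / 2) (k / 64)).image (· + (![((k / 2 : ℕ) : ℤ), (k / 4 : ℕ)] : Site 2))).sym2 ∪
    ((rectangle (k - 1 - k / 2) (k / 64)).image (· + (![((k / 2 : ℕ) : ℤ), -((k / 4 : ℕ) + (k / 64 : ℕ) : ℤ)] : Site 2))).sym2 ∪
    ((rectangle (k - 1 - k / 2) (k / 64)).image (· + (![-(k : ℤ) + 1, 0] : Site 2))).sym2)

/-- The pairs read by the dual corridors and the closed rows. [folklore] -/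
def uPairsM : Finset (Sym2 (Site 2)) :=
  (dualFaceCrossingPairs ![0, (N : ℤ) + 2] (N / 64 + 1) (NT - N - 2) ∪
    dualFaceCrossingPairs ![0, -(SB : ℤ)] (N / 64 + 1) (SB - N - 2)) ∪
  ((dualFaceCrossingPairs ![0, ((k / 2 : ℕ) : ℤ) + 1] (k / 64 + 1) (k - 3 - k / 2) ∪
      rowEdges 0 ((k / 2 : ℕ) : ℤ) (k / 64)) ∪
    (dualFaceCrossingPairs ![0, -(k : ℤ) + 2] (k / 64 + 1) (k - 3 - k / 2) ∪
      rowEdges 0 (-((k / 2 : ℕ) : ℤ)) (k / 64)))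

variable {k N WL ER SB NT}

/-- Coordinates of the sites of the open-corridor pairs. [folklore] -/
theorem uPairsP_sites (hk : 128 ≤ k) (hN : 2 * k ≤ N) (hWL : 3 * N ≤ WL)
    {e : Sym2 (Site 2)} (he : e ∈ uPairsP k N WL ER) {x : Site 2} (hx : x ∈ e) :
    ((N : ℤ) + 1 ≤ x 0 ∨ x 0 + 1 ≤ -(N : ℤ)) ∧ |x 1| ≤ (N / 4 : ℕ) + (N / 64 : ℕ) ∨
      (((k / 2 : ℕ) : ℤ) ≤ x 0 ∨ x 0 ≤ -((k / 2 : ℕ) : ℤ)) ∧ |x 0| ≤ k - 1 ∧ |x 1| ≤ (k / 4 : ℕ) + (k / 64 : ℕ) := by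
  simp only [uPairsP, Finset.mem_union] at he
  rcases he with ((he | he) | he) | ((he | he) | he) <;>
    have h := apply_le_of_mem_rectanglePairs he hx <;>
    simp only [Matrix.cons_val_zero, Matrix.cons_val_one] at h <;> [left; left; left; right; right; right] <;>
    refine ⟨by omega, ?_⟩ <;> (try refine ⟨abs_le.2 ⟨by omega, by omega⟩, ?_⟩) <;> exact abs_le.2 ⟨by omega, by omega⟩

/-- Coordinates of the sites of the dual-corridor pairs. [folklore] -/
theorem uPairsM_sites (hk : 128 ≤ k) (hN : 2 * k ≤ N) (hSB : 3 * N ≤ SB)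
    {e : Sym2 (Site 2)} (he : e ∈ uPairsM k N SB NT) {x : Site 2} (hx : x ∈ e) :
    0 ≤ x 0 ∧ (x 0 ≤ (N / 64 : ℕ) + 1 ∧ ((N : ℤ) + 1 ≤ x 1 ∨ x 1 ≤ -(N : ℤ) - 1) ∨
      x 0 ≤ (k / 64 : ℕ) + 1 ∧ ((k / 2 : ℕ) ≤ |x 1| ∧ |x 1| ≤ k - 1)) := by
  simp only [uPairsM, Finset.mem_union] at he
  rcases he with (he | he) | ((he | he) | (he | he))
  · have h := apply_le_of_mem_dualFaceCrossingPairs he hx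
    simp only [Matrix.cons_val_zero, Matrix.cons_val_one] at h
    exact ⟨by omega, Or.inl ⟨by omega, by omega⟩⟩
  · have h := apply_le_of_mem_dualFaceCrossingPairs he hx
    simp only [Matrix.cons_val_zero, Matrix.cons_val_one] at h
    exact ⟨by omega, Or.inl ⟨by omega, by omega⟩⟩
  · have h := apply_le_of_mem_dualFaceCrossingPairs he hx
    simp only [Matrix.cons_val_zero, Matrix.cons_val_one] at h
    exact ⟨by omega, Or.inr ⟨by omega, by rw [abs_of_nonneg (by omega)]; omega, by rw [abs_of_nonneg (by omega)]; omega⟩⟩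
  · have h := apply_le_of_mem_rowEdges he hx
    exact ⟨by omega, Or.inr ⟨by omega, by rw [abs_of_nonneg (by omega)]; omega, by rw [abs_of_nonneg (by omega)]; omega⟩⟩
  · have h := apply_le_of_mem_dualFaceCrossingPairs he hx
    simp only [Matrix.cons_val_zero, Matrix.cons_val_one] at h
    exact ⟨by omega, Or.inr ⟨by omega, by rw [abs_of_nonpos (by omega)]; omega, by rw [abs_of_nonpos (by omega)]; omega⟩⟩
  · have h := apply_le_of_mem_rowEdges he hx
    exact ⟨by omega, Or.inr ⟨by omega, by rw [abs_of_nonpos (by omega)]; omega, by rw [abs_of_nonpos (by omega)]; omega⟩⟩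

end UEvents

/-! ### Geometry of the pair sets of `(U)` -/

section UGeometry

open scoped Classical

variable {k N WL ER SB NT : ℕ}

/-- Coordinates of a site of one of the four zones: in the big box `B(N + N/8 + 1)`, of sup-norm
at least `k/2`, and more. [folklore] -/
theorem zone_sites (hk : 128 ≤ k) (hN : 2 * k ≤ N) {x : Site 2}
    (hx : x ∈ zdSepZoneR k N ∪ zdSepZoneL k N ∪ (zdSepZoneT k N ∪ zdSepZoneB k N)) :
    (|x 0| ≤ (N : ℤ) + (N / 8 : ℕ) + 1 ∧ |x 1| ≤ (N : ℤ) + (N / 8 : ℕ) + 1) ∧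
      (((k / 2 : ℕ) : ℤ) + 1 ≤ |x 0| ∨ ((k / 2 : ℕ) : ℤ) + 1 ≤ |x 1|) ∧
      ((x ∈ zdSepZoneR k N ∪ zdSepZoneL k N) →
        ((k : ℤ) ≤ |x 0| ∨ (k : ℤ) ≤ |x 1|) ∧ |x 0| ≤ N ∧ |x 1| ≤ N ∨
        (k : ℤ) - (k / 8 : ℕ) ≤ |x 0| ∧ |x 1| ≤ ((N / 4 : ℕ) : ℤ) + (N / 64 : ℕ) + (N / 64 : ℕ) + (N / 8 : ℕ)) ∧
      ((x ∈ zdSepZoneT k N ∪ zdSepZoneB k N) →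
        ((k : ℤ) ≤ |x 0| ∨ (k : ℤ) ≤ |x 1|) ∧ |x 0| ≤ N ∧ |x 1| ≤ N ∨
        |x 0| ≤ ((N / 64 : ℕ) : ℤ) + (N / 8 : ℕ) + 1 ∧ (k : ℤ) - (k / 8 : ℕ) - 1 ≤ |x 1|) := by
  have hk1 : 1 ≤ k := by omega
  have hann : x ∈ sqAnnulus k N → ((k : ℤ) ≤ |x 0| ∨ (k : ℤ) ≤ |x 1|) ∧ |x 0| ≤ N ∧ |x 1| ≤ N := by
    intro h
    rw [mem_sqAnnulus_iff hk1, Fin.forall_fin_two, Fin.exists_fin_two] at h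
    obtain ⟨⟨h0, h1⟩, h2⟩ := h
    refine ⟨?_, abs_le.2 ⟨h0.1, h0.2⟩, abs_le.2 ⟨h1.1, h1.2⟩⟩
    rcases h2 with h2 | h2 <;> [left; right] <;> rw [le_abs] <;> omega
  have hR : x ∈ zdSepZoneR k N ∪ zdSepZoneL k N →
      ((k : ℤ) ≤ |x 0| ∨ (k : ℤ) ≤ |x 1|) ∧ |x 0| ≤ N ∧ |x 1| ≤ N ∨
        (k : ℤ) - (k / 8 : ℕ) ≤ |x 0| ∧ |x 1| ≤ ((N / 4 : ℕ) : ℤ) + (N / 64 : ℕ) + (N / 64 : ℕ) + (N / 8 : ℕ) := by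
    rintro ((h | h | h) | (h | h | h))
    · exact Or.inl (hann h)
    · right; obtain ⟨h1, -, h3⟩ := h; exact ⟨by rw [le_abs]; omega, h3⟩
    · right; obtain ⟨h1, -, h3⟩ := h; exact ⟨by rw [le_abs]; omega, by omega⟩
    · exact Or.inl (hann h)
    · right; obtain ⟨-, h2, h3⟩ := h; exact ⟨by rw [le_abs]; omega, by omega⟩
    · right; obtain ⟨-, h2, h3⟩ := h; exact ⟨by rw [le_abs]; omega, by omega⟩
  have hT : x ∈ zdSepZoneT k N ∪ zdSepZoneB k N →
      ((k : ℤ) ≤ |x 0| ∨ (k : ℤ) ≤ |x 1|) ∧ |x 0| ≤ N ∧ |x 1| ≤ N ∨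
        |x 0| ≤ ((N / 64 : ℕ) : ℤ) + (N / 8 : ℕ) + 1 ∧ (k : ℤ) - (k / 8 : ℕ) - 1 ≤ |x 1| := by
    rintro ((h | h | h) | (h | h | h))
    · exact Or.inl (hann h)
    · right; obtain ⟨h1, h2, h3, -⟩ := h; exact ⟨abs_le.2 ⟨by omega, by omega⟩, by rw [le_abs]; omega⟩
    · right; obtain ⟨h1, h2, h3, -⟩ := h; exact ⟨abs_le.2 ⟨by omega, by omega⟩, by rw [le_abs]; omega⟩
    · exact Or.inl (hann h)
    · right; obtain ⟨h1, h2, -, h4⟩ := h; exact ⟨abs_le.2 ⟨by omega, by omega⟩, by rw [le_abs]; omega⟩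
    · right; obtain ⟨h1, h2, -, h4⟩ := h; exact ⟨abs_le.2 ⟨by omega, by omega⟩, by rw [le_abs]; omega⟩
  have hbig : |x 0| ≤ (N : ℤ) + (N / 8 : ℕ) + 1 ∧ |x 1| ≤ (N : ℤ) + (N / 8 : ℕ) + 1 := by
    rcases hx with ((h | h | h) | (h | h | h)) | ((h | h | h) | (h | h | h))
    · have := hann h; exact ⟨by omega, by omega⟩
    · obtain ⟨h1, h2, h3⟩ := h; exact ⟨abs_le.2 ⟨by omega, by omega⟩, by omega⟩
    · obtain ⟨h1, h2, h3⟩ := h; exact ⟨abs_le.2 ⟨by omega, by omega⟩, by omega⟩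
    · have := hann h; exact ⟨by omega, by omega⟩
    · obtain ⟨h1, h2, h3⟩ := h; exact ⟨abs_le.2 ⟨by omega, by omega⟩, by omega⟩
    · obtain ⟨h1, h2, h3⟩ := h; exact ⟨abs_le.2 ⟨by omega, by omega⟩, by omega⟩
    · have := hann h; exact ⟨by omega, by omega⟩
    · obtain ⟨h1, h2, h3, h4⟩ := h; exact ⟨abs_le.2 ⟨by omega, by omega⟩, abs_le.2 ⟨by omega, by omega⟩⟩
    · obtain ⟨h1, h2, h3, h4⟩ := h; exact ⟨abs_le.2 ⟨by omega, by omega⟩, abs_le.2 ⟨by omega, by omega⟩⟩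
    · have := hann h; exact ⟨by omega, by omega⟩
    · obtain ⟨h1, h2, h3, h4⟩ := h; exact ⟨abs_le.2 ⟨by omega, by omega⟩, abs_le.2 ⟨by omega, by omega⟩⟩
    · obtain ⟨h1, h2, h3, h4⟩ := h; exact ⟨abs_le.2 ⟨by omega, by omega⟩, abs_le.2 ⟨by omega, by omega⟩⟩
  refine ⟨hbig, ?_, hR, hT⟩
  rcases hx with hx | hx
  · rcases hR hx with ⟨h1 | h1, -, -⟩ | ⟨h1, -⟩
    · left; omega
    · right; omega
    · left; omega
  · rcases hT hx with ⟨h1 | h1, -, -⟩ | ⟨-, h1⟩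
    · left; omega
    · right; omega
    · right; omega

variable (k N WL ER SB NT)

/-- The sites of the four zones, as a finite set. [folklore] -/
def uZoneSites : Finset (Site 2) :=
  (box 2 (N + N / 8 + 1)).filter fun v => v ∈ zdSepZoneR k N ∪ zdSepZoneL k N ∪ (zdSepZoneT k N ∪ zdSepZoneB k N)

/-- **The common pairs `S`** of the generalised FKG inequality for `(U)`: pairs of zone sites that
are neither open-corridor nor dual-corridor pairs. [folklore] -/
def uPairsS : Finset (Sym2 (Site 2)) :=
  (uZoneSites k N).sym2 \ (uPairsP k N WL ER ∪ uPairsM k N SB NT)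

variable {k N WL ER SB NT}

/-- A zone site is in `uZoneSites`. [folklore] -/
theorem mem_uZoneSites (hk : 128 ≤ k) (hN : 2 * k ≤ N) {x : Site 2}
    (hx : x ∈ zdSepZoneR k N ∪ zdSepZoneL k N ∪ (zdSepZoneT k N ∪ zdSepZoneB k N)) : x ∈ uZoneSites k N := by
  rw [uZoneSites, Finset.mem_filter, mem_box, Fin.forall_fin_two]
  obtain ⟨⟨h0, h1⟩, -⟩ := zone_sites hk hN hx
  push_cast
  exact ⟨⟨⟨by have := (abs_le.1 h0).1; omega, by have := (abs_le.1 h0).2; omega⟩,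
    ⟨by have := (abs_le.1 h1).1; omega, by have := (abs_le.1 h1).2; omega⟩⟩, hx⟩

/-- **(G1)** No site of a dual-corridor pair lies in the right or left zone. [folklore] -/
theorem uPairsM_sites_notMem (hk : 128 ≤ k) (hN : 2 * k ≤ N) (hSB : 3 * N ≤ SB)
    {e : Sym2 (Site 2)} (he : e ∈ uPairsM k N SB NT) {x : Site 2} (hx : x ∈ e) :
    x ∉ zdSepZoneR k N ∪ zdSepZoneL k N := by
  intro hz
  have h := uPairsM_sites hk hN hSB he hx
  obtain ⟨-, -, hR, -⟩ := zone_sites hk hN (Or.inl hz)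
  have habs0 : |x 0| = x 0 := abs_of_nonneg h.1
  rcases hR hz with ⟨h1, h2, h3⟩ | ⟨h1, h2⟩
  · rcases h.2 with ⟨h4, h5⟩ | ⟨h4, h5, h6⟩
    · rcases h5 with h5 | h5 <;> [have := le_abs_self (x 1); have := neg_abs_le (x 1)] <;> omega
    · omega
  · rcases h.2 with ⟨h4, h5⟩ | ⟨h4, h5, h6⟩
    · rcases h5 with h5 | h5 <;> [have := le_abs_self (x 1); have := neg_abs_le (x 1)] <;> omega
    · omega

/-- **(G2)** No site of an open-corridor pair lies in the top or bottom zone. [folklore] -/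
theorem uPairsP_sites_notMem (hk : 128 ≤ k) (hN : 2 * k ≤ N) (hWL : 3 * N ≤ WL)
    {e : Sym2 (Site 2)} (he : e ∈ uPairsP k N WL ER) {x : Site 2} (hx : x ∈ e) :
    x ∉ zdSepZoneT k N ∪ zdSepZoneB k N := by
  intro hz
  have h := uPairsP_sites hk hN hWL he hx
  obtain ⟨-, -, -, hT⟩ := zone_sites hk hN (Or.inr hz)
  rcases hT hz with ⟨h1, h2, h3⟩ | ⟨h1, h2⟩
  · rcases h with ⟨h4, h5⟩ | ⟨h4, h5, h6⟩
    · rcases h4 with h4 | h4 <;> [have := le_abs_self (x 0); have := neg_abs_le (x 0)] <;> omega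
    · omega
  · rcases h with ⟨h4, h5⟩ | ⟨h4, h5, h6⟩
    · rcases h4 with h4 | h4 <;> [have := le_abs_self (x 0); have := neg_abs_le (x 0)] <;> omega
    · omega

/-- **(G3)** Open-corridor pairs and dual-corridor pairs are disjoint. [folklore] -/
theorem disjoint_uPairsP_uPairsM (hk : 128 ≤ k) (hN : 2 * k ≤ N) (hWL : 3 * N ≤ WL) (hSB : 3 * N ≤ SB) :
    Disjoint (uPairsP k N WL ER) (uPairsM k N SB NT) := by
  rw [Finset.disjoint_left]
  intro e heP heM
  obtain ⟨x, hx⟩ : ∃ x, x ∈ e := ⟨e.out.1, Sym2.out_fst_mem e⟩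
  have hP := uPairsP_sites hk hN hWL heP hx
  have hM := uPairsM_sites hk hN hSB heM hx
  rcases hP with ⟨h1, h2⟩ | ⟨h1, h2, h3⟩ <;> rcases hM.2 with ⟨h4, h5⟩ | ⟨h4, h5, h6⟩
  · rcases h5 with h5 | h5 <;> [have := le_abs_self (x 1); have := neg_abs_le (x 1)] <;> omega
  · omega
  · rcases h5 with h5 | h5 <;> [have := le_abs_self (x 1); have := neg_abs_le (x 1)] <;> omega
  · omega

/-- **(G4)** The forced pairs of the hub are disjoint from all the other pairs. [folklore] -/
theorem disjoint_hubPairs_uPairs (hk : 128 ≤ k) (hN : 2 * k ≤ N) (hWL : 3 * N ≤ WL) (hSB : 3 * N ≤ SB) :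
    Disjoint (↑(uPairsS k N WL ER SB NT) ∪ ↑(uPairsP k N WL ER) ∪ ↑(uPairsM k N SB NT) : Set (Sym2 (Site 2)))
      ↑(hubPairs (k / 2 - 1)) := by
  rw [Set.disjoint_right]
  rintro e he
  rw [Finset.mem_coe, hubPairs, Finset.mem_filter] at he
  obtain ⟨-, x, hx, hxK⟩ := he
  rw [mem_box, Fin.forall_fin_two] at hxK
  have hK : ((k / 2 - 1 : ℕ) : ℤ) = ((k / 2 : ℕ) : ℤ) - 1 := by push_cast [Nat.cast_sub (show 1 ≤ k / 2 by omega)]; ring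
  rw [hK] at hxK
  rintro ((heS | heP) | heM)
  · rw [Finset.mem_coe, uPairsS, Finset.mem_sdiff, Finset.mem_sym2_iff] at heS
    have hz := (Finset.mem_filter.1 (heS.1 x hx)).2
    obtain ⟨-, h2, -⟩ := zone_sites hk hN hz
    rcases h2 with h2 | h2 <;>
      [have := abs_le.2 (And.intro hxK.1.1 hxK.1.2); have := abs_le.2 (And.intro hxK.2.1 hxK.2.2)] <;> omega
  · have hP := uPairsP_sites hk hN hWL heP hx
    rcases hP with ⟨h1, -⟩ | ⟨h1, -⟩ <;> omega
  · have hM := uPairsM_sites hk hN hSB heM hx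
    rcases hM.2 with ⟨-, h5⟩ | ⟨-, h5, -⟩
    · rcases h5 with h5 | h5 <;> omega
    · have := abs_le.1 (le_refl |x 1|); rw [le_abs] at h5; omega

end UGeometry

/-! ### The probability of the glued event of `(U)` -/

section UProbability

open scoped Classical

/-- RSW lower bound for a corridor crossing of aspect ratio at most `1024`. [cite: BollobasRiordan2006, Ch. 3, Cor. 6] -/
theorem le_real_lrCrossingAt_of_rsw {c : ℝ} (hc : ∀ l : ℕ, 1 ≤ l → c ≤ crossingProb half (1024 * l - 1) (l - 1))
    (u : Site 2) {M n : ℕ} (hM : M ≤ 1024 * (n + 1) - 1) :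
    c ≤ (bondPercolation (zdGraph 2) half).real (lrCrossingAt u M n) := by
  rw [bondPercolation_real_lrCrossingAt]
  have h := hc (n + 1) (by omega)
  rw [Nat.add_sub_cancel] at h
  exact h.trans (crossingProb_anti_left half hM n)

/-- RSW lower bound for a dual corridor crossing of aspect ratio at most `1024`. [cite: BollobasRiordan2006, Ch. 3, Cor. 6 and Cor. 3(i)] -/
theorem le_real_dualFaceCrossing_of_rsw {c : ℝ} (hc : ∀ l : ℕ, 1 ≤ l → c ≤ crossingProb half (1024 * l - 1) (l - 1))
    (u : Site 2) {m n' : ℕ} (hn : n' + 1 ≤ 1024 * (m + 1) - 1) :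
    c ≤ (bondPercolation (zdGraph 2) half).real (dualFaceCrossing u (m + 1) n') := by
  refine le_trans ?_ (crossingProb_le_real_dualFaceCrossing u m n')
  have h := hc (m + 1) (by omega)
  rw [Nat.add_sub_cancel] at h
  exact h.trans (crossingProb_anti_left half hn m)

/-- Harris for two increasing events with lower bounds. [folklore] -/
theorem le_real_inter_of_upper {A B : Set (BondConfig (Site 2))} {a b : ℝ} (ha0 : 0 ≤ a) (hb0 : 0 ≤ b)
    (hA : IsUpperSet A) (hB : IsUpperSet B) (hAm : MeasurableSet A) (hBm : MeasurableSet B)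
    (ha : a ≤ (bondPercolation (zdGraph 2) half).real A) (hb : b ≤ (bondPercolation (zdGraph 2) half).real B) :
    a * b ≤ (bondPercolation (zdGraph 2) half).real (A ∩ B) :=
  (mul_le_mul ha hb hb0 (ha0.trans ha)).trans (harris_fkg_holds (zdGraph 2) half hA hB hAm hBm)

/-- Harris for two decreasing events with lower bounds. [folklore] -/
theorem le_real_inter_of_lower {A B : Set (BondConfig (Site 2))} {a b : ℝ} (ha0 : 0 ≤ a) (hb0 : 0 ≤ b)
    (hA : IsLowerSet A) (hB : IsLowerSet B) (hAm : MeasurableSet A) (hBm : MeasurableSet B)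
    (ha : a ≤ (bondPercolation (zdGraph 2) half).real A) (hb : b ≤ (bondPercolation (zdGraph 2) half).real B) :
    a * b ≤ (bondPercolation (zdGraph 2) half).real (A ∩ B) :=
  (mul_le_mul ha hb hb0 (ha0.trans ha)).trans (harris_fkg_lower (zdGraph 2) half hA hB hAm hBm)

variable {k N WL ER SB NT : ℕ}

/-- The open corridors of `(U)` are increasing. [folklore] -/
theorem isUpperSet_uCorrOpen : IsUpperSet (uCorrOpen k N WL ER) :=
  (((isUpperSet_lrCrossingAt _ _ _).inter (isUpperSet_lrCrossingAt _ _ _)).inter (isUpperSet_lrCrossingAt _ _ _)).inter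
    (((isUpperSet_lrCrossingAt _ _ _).inter (isUpperSet_lrCrossingAt _ _ _)).inter (isUpperSet_lrCrossingAt _ _ _))

/-- The open corridors of `(U)` are measurable. [folklore] -/
theorem measurableSet_uCorrOpen : MeasurableSet (uCorrOpen k N WL ER) :=
  (((measurableSet_lrCrossingAt _ _ _).inter (measurableSet_lrCrossingAt _ _ _)).inter (measurableSet_lrCrossingAt _ _ _)).inter
    (((measurableSet_lrCrossingAt _ _ _).inter (measurableSet_lrCrossingAt _ _ _)).inter (measurableSet_lrCrossingAt _ _ _))

/-- The rows-and-dual corridors of `(U)` are decreasing. [folklore] -/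
theorem isLowerSet_uCorrDual : IsLowerSet (uCorrDual k N SB NT) :=
  ((isLowerSet_dualFaceCrossing _ _ _).inter (isLowerSet_dualFaceCrossing _ _ _)).inter
    (((isLowerSet_dualFaceCrossing _ _ _).inter (isLowerSet_rowClosed _ _ _)).inter
      ((isLowerSet_dualFaceCrossing _ _ _).inter (isLowerSet_rowClosed _ _ _)))

/-- The dual corridors of `(U)` are measurable. [folklore] -/
theorem measurableSet_uCorrDual : MeasurableSet (uCorrDual k N SB NT) :=
  ((measurableSet_dualFaceCrossing _ _ _).inter (measurableSet_dualFaceCrossing _ _ _)).inter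
    (((measurableSet_dualFaceCrossing _ _ _).inter (measurableSet_forall_notMem _)).inter
      ((measurableSet_dualFaceCrossing _ _ _).inter (measurableSet_forall_notMem _)))

/-- A generic six-fold union bookkeeping. [folklore] -/
theorem determinedBy_inter6 {A₁ A₂ A₃ A₄ A₅ A₆ : Set (BondConfig (Site 2))} {F₁ F₂ F₃ F₄ F₅ F₆ : Finset (Sym2 (Site 2))}
    (h₁ : DeterminedBy A₁ ↑F₁) (h₂ : DeterminedBy A₂ ↑F₂) (h₃ : DeterminedBy A₃ ↑F₃) (h₄ : DeterminedBy A₄ ↑F₄)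
    (h₅ : DeterminedBy A₅ ↑F₅) (h₆ : DeterminedBy A₆ ↑F₆) :
    DeterminedBy (A₁ ∩ A₂ ∩ A₃ ∩ (A₄ ∩ A₅ ∩ A₆)) ↑(F₁ ∪ F₂ ∪ F₃ ∪ (F₄ ∪ F₅ ∪ F₆)) := by
  push_cast
  refine (((h₁.mono ?_).inter (h₂.mono ?_)).inter (h₃.mono ?_)).inter (((h₄.mono ?_).inter (h₅.mono ?_)).inter (h₆.mono ?_)) <;>
    intro e he <;> simp only [Set.mem_union] <;> tauto

/-- The open corridors are determined by `uPairsP`. [folklore] -/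
theorem determinedBy_uCorrOpen : DeterminedBy (uCorrOpen k N WL ER) ↑(uPairsP k N WL ER) := by
  unfold uCorrOpen uPairsP
  exact determinedBy_inter6 (determinedBy_openCrossing_image _ _ _ _) (determinedBy_openCrossing_image _ _ _ _)
    (determinedBy_openCrossing_image _ _ _ _) (determinedBy_openCrossing_image _ _ _ _)
    (determinedBy_openCrossing_image _ _ _ _) (determinedBy_openCrossing_image _ _ _ _)

/-- The dual corridors are determined by `uPairsM`. [folklore] -/
theorem determinedBy_uCorrDual : DeterminedBy (uCorrDual k N SB NT) ↑(uPairsM k N SB NT) := by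
  unfold uCorrDual uPairsM
  have e : ∀ (A B C D E F : Set (BondConfig (Site 2))), A ∩ B ∩ (C ∩ D ∩ (E ∩ F)) = A ∩ B ∩ C ∩ (D ∩ E ∩ F) := by
    intro A B C D E F; simp only [Set.inter_assoc]
  have e' : ∀ (A B C D E F : Finset (Sym2 (Site 2))), A ∪ B ∪ (C ∪ D ∪ (E ∪ F)) = A ∪ B ∪ C ∪ (D ∪ E ∪ F) := by
    intro A B C D E F; simp only [Finset.union_assoc]
  rw [e, e']
  exact determinedBy_inter6 (determinedBy_dualFaceCrossing _ _ _) (determinedBy_dualFaceCrossing _ _ _)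
    (determinedBy_dualFaceCrossing _ _ _) (determinedBy_forall_notMem _)
    (determinedBy_dualFaceCrossing _ _ _) (determinedBy_forall_notMem _)

/-- The pairs of the right and left zones are common or open-corridor pairs. [folklore] -/
theorem zoneRL_sym2_subset (hk : 128 ≤ k) (hN : 2 * k ≤ N) (hSB : 3 * N ≤ SB) :
    (zdSepZoneR k N).sym2 ∪ (zdSepZoneL k N).sym2 ⊆ (↑(uPairsS k N WL ER SB NT) ∪ ↑(uPairsP k N WL ER) : Set (Sym2 (Site 2))) := by
  intro e he
  have hz : ∀ x ∈ e, x ∈ zdSepZoneR k N ∪ zdSepZoneL k N := fun x hx => by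
    rcases he with he | he
    · exact Or.inl (Set.mem_sym2_iff_subset.1 he hx)  -- may need the right name
    · exact Or.inr (Set.mem_sym2_iff_subset.1 he hx)
  by_cases hP : e ∈ uPairsP k N WL ER
  · exact Or.inr hP
  · left
    rw [Finset.mem_coe, uPairsS, Finset.mem_sdiff, Finset.mem_union, Finset.mem_sym2_iff]
    refine ⟨fun x hx => mem_uZoneSites hk hN (Or.inl (hz x hx)), ?_⟩
    rintro (h | h)
    · exact hP h
    · obtain ⟨x, hx⟩ : ∃ x, x ∈ e := ⟨e.out.1, Sym2.out_fst_mem e⟩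
      exact uPairsM_sites_notMem hk hN hSB h hx (hz x hx)

/-- The pairs of the top and bottom zones are common or dual-corridor pairs. [folklore] -/
theorem zoneTB_sym2_subset (hk : 128 ≤ k) (hN : 2 * k ≤ N) (hWL : 3 * N ≤ WL) :
    (zdSepZoneT k N).sym2 ∪ (zdSepZoneB k N).sym2 ⊆ (↑(uPairsS k N WL ER SB NT) ∪ ↑(uPairsM k N SB NT) : Set (Sym2 (Site 2))) := by
  intro e he
  have hz : ∀ x ∈ e, x ∈ zdSepZoneT k N ∪ zdSepZoneB k N := fun x hx => by
    rcases he with he | he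
    · exact Or.inl (Set.mem_sym2_iff_subset.1 he hx)
    · exact Or.inr (Set.mem_sym2_iff_subset.1 he hx)
  by_cases hM : e ∈ uPairsM k N SB NT
  · exact Or.inr hM
  · left
    rw [Finset.mem_coe, uPairsS, Finset.mem_sdiff, Finset.mem_union, Finset.mem_sym2_iff]
    refine ⟨fun x hx => mem_uZoneSites hk hN (Or.inr (hz x hx)), ?_⟩
    rintro (h | h)
    · obtain ⟨x, hx⟩ : ∃ x, x ∈ e := ⟨e.out.1, Sym2.out_fst_mem e⟩
      exact uPairsP_sites_notMem hk hN hWL h hx (hz x hx)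
    · exact hM h

variable (k N WL ER SB NT)

/-- **The glued event of `(U)`**: the well-separated five arms at scales `k ≤ N`, the ten
corridors with the two closed rows, and the hub. [cite: Nolin2008, §4.3, Prop. 12 and §4.5, Prop. 17] -/
def uGlued : Set (BondConfig (Site 2)) :=
  zdFiveArmSep k N ∩ (uCorrOpen k N WL ER ∩ uCorrDual k N SB NT) ∩ zdHub (k / 2 - 1) (k / 4) (k / 64)

variable {k N WL ER SB NT}

/-- **The probability of the glued event** (Kesten 1987, Lemma 6 with (2.43); Nolin 2008,
Prop. 12 and Prop. 17): by the generalised FKG inequality (the arms being determined by the zones,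
the corridors by disjoint pair sets), RSW in the ten corridors, the two closed rows, and the hub
(independent of everything else),
`P(uGlued) ≥ c¹⁰ · 2^{-2(k/64+1)} · 2^{-|hubPairs|} · P(zdFiveArmSep k N)`. [cite: Nolin2008, §4.3, Prop. 12 (i)] -/
theorem real_uGlued_ge (hk : 128 ≤ k) (hN : 2 * k ≤ N) (hWL : 3 * N ≤ WL) (hWL' : WL ≤ 5 * N)
    (hER : 3 * N ≤ ER) (hER' : ER ≤ 5 * N) (hSB : 3 * N ≤ SB) (hSB' : SB ≤ 5 * N) (hNT' : NT ≤ 5 * N)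
    {c : ℝ} (hc0 : 0 < c) (hc : ∀ l : ℕ, 1 ≤ l → c ≤ crossingProb half (1024 * l - 1) (l - 1)) :
    c ^ 10 * (1 / 2 : ℝ) ^ (2 * (k / 64 + 1)) * (1 / 2 : ℝ) ^ (hubPairs (k / 2 - 1)).card *
        (bondPercolation (zdGraph 2) half).real (zdFiveArmSep k N) ≤
      (bondPercolation (zdGraph 2) half).real (uGlued k N WL ER SB NT) := by
  set μ := bondPercolation (zdGraph 2) half with hμ
  -- the generalised FKG inequality
  have hSP : Disjoint (uPairsS k N WL ER SB NT) (uPairsP k N WL ER) :=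
    disjoint_sdiff_self_left.mono_right le_sup_left
  have hSM : Disjoint (uPairsS k N WL ER SB NT) (uPairsM k N SB NT) :=
    disjoint_sdiff_self_left.mono_right le_sup_right
  have hPM := disjoint_uPairsP_uPairsM (ER := ER) (NT := NT) hk hN hWL hSB
  have hRL := zoneRL_sym2_subset (WL := WL) (ER := ER) (NT := NT) hk hN hSB
  have hTB := zoneTB_sym2_subset (ER := ER) (SB := SB) (NT := NT) hk hN hWL
  have dAp : DeterminedBy (zdSepOpenPairR k N ∩ zdSepOpenArmL k N) (↑(uPairsS k N WL ER SB NT) ∪ ↑(uPairsP k N WL ER)) :=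
    (determinedBy_zdSepOpenPairR (Set.subset_union_left.trans hRL)).inter
      (determinedBy_zdSepOpenArmL (Set.subset_union_right.trans hRL))
  have dAm : DeterminedBy (zdSepDualArmT k N ∩ zdSepDualArmB k N) (↑(uPairsS k N WL ER SB NT) ∪ ↑(uPairsM k N SB NT)) :=
    (determinedBy_zdSepDualArmT (Set.subset_union_left.trans hTB)).inter
      (determinedBy_zdSepDualArmB (Set.subset_union_right.trans hTB))
  have hFKG := bondPercolation_locallyMonotone_fkg (zdGraph 2) half hSP hSM hPM
    (isUpperSet_zdSepOpenPairR_inter_zdSepOpenArmL _ _) (isLowerSet_zdSepDualArmT_inter_zdSepDualArmB _ _)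
    (isUpperSet_uCorrOpen (k := k) (N := N) (WL := WL) (ER := ER)) (isLowerSet_uCorrDual (k := k) (N := N) (SB := SB) (NT := NT))
    dAp dAm determinedBy_uCorrOpen determinedBy_uCorrDual
  -- measurability of the arms-and-corridors event and independence from the hub
  have dX : DeterminedBy (zdSepOpenPairR k N ∩ zdSepOpenArmL k N ∩ (zdSepDualArmT k N ∩ zdSepDualArmB k N) ∩
      (uCorrOpen k N WL ER ∩ uCorrDual k N SB NT))
      (↑(uPairsS k N WL ER SB NT) ∪ ↑(uPairsP k N WL ER) ∪ ↑(uPairsM k N SB NT)) :=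
    ((dAp.mono Set.subset_union_left).inter (dAm.mono (Set.union_subset_union_left _ Set.subset_union_left))).inter
      ((determinedBy_uCorrOpen.mono (Set.subset_union_right.trans Set.subset_union_left)).inter
        (determinedBy_uCorrDual.mono Set.subset_union_right))
  have hXm : MeasurableSet (zdSepOpenPairR k N ∩ zdSepOpenArmL k N ∩ (zdSepDualArmT k N ∩ zdSepDualArmB k N) ∩
      (uCorrOpen k N WL ER ∩ uCorrDual k N SB NT)) := by
    have : (↑(uPairsS k N WL ER SB NT) ∪ ↑(uPairsP k N WL ER) ∪ ↑(uPairsM k N SB NT) : Set (Sym2 (Site 2))) =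
        ↑(uPairsS k N WL ER SB NT ∪ uPairsP k N WL ER ∪ uPairsM k N SB NT) := by push_cast; rfl
    rw [this] at dX
    exact dX.measurableSet_of_finset
  have hind := bondPercolation_real_inter_of_disjoint (zdGraph 2) half (disjoint_hubPairs_uPairs (NT := NT) hk hN hWL hSB)
    dX (determinedBy_zdHub (k / 2 - 1) (k / 4) (k / 64)) hXm (measurableSet_zdHub _ _ _)
  -- the corridor bounds
  have hc0' := hc0.le
  have hBp : c ^ 6 ≤ μ.real (uCorrOpen k N WL ER) := by
    have e6 : c ^ 6 = c * c * c * (c * c * c) := by ring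
    rw [e6]
    refine le_real_inter_of_upper (by positivity) (by positivity)
      (((isUpperSet_lrCrossingAt _ _ _).inter (isUpperSet_lrCrossingAt _ _ _)).inter (isUpperSet_lrCrossingAt _ _ _))
      (((isUpperSet_lrCrossingAt _ _ _).inter (isUpperSet_lrCrossingAt _ _ _)).inter (isUpperSet_lrCrossingAt _ _ _))
      (((measurableSet_lrCrossingAt _ _ _).inter (measurableSet_lrCrossingAt _ _ _)).inter (measurableSet_lrCrossingAt _ _ _))
      (((measurableSet_lrCrossingAt _ _ _).inter (measurableSet_lrCrossingAt _ _ _)).inter (measurableSet_lrCrossingAt _ _ _))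
      ?_ ?_
    · refine le_real_inter_of_upper (by positivity) hc0'
        ((isUpperSet_lrCrossingAt _ _ _).inter (isUpperSet_lrCrossingAt _ _ _)) (isUpperSet_lrCrossingAt _ _ _)
        ((measurableSet_lrCrossingAt _ _ _).inter (measurableSet_lrCrossingAt _ _ _)) (measurableSet_lrCrossingAt _ _ _)
        (le_real_inter_of_upper hc0' hc0' (isUpperSet_lrCrossingAt _ _ _) (isUpperSet_lrCrossingAt _ _ _)
          (measurableSet_lrCrossingAt _ _ _) (measurableSet_lrCrossingAt _ _ _)
          (le_real_lrCrossingAt_of_rsw hc _ (by omega)) (le_real_lrCrossingAt_of_rsw hc _ (by omega)))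
        (le_real_lrCrossingAt_of_rsw hc _ (by omega))
    · refine le_real_inter_of_upper (by positivity) hc0'
        ((isUpperSet_lrCrossingAt _ _ _).inter (isUpperSet_lrCrossingAt _ _ _)) (isUpperSet_lrCrossingAt _ _ _)
        ((measurableSet_lrCrossingAt _ _ _).inter (measurableSet_lrCrossingAt _ _ _)) (measurableSet_lrCrossingAt _ _ _)
        (le_real_inter_of_upper hc0' hc0' (isUpperSet_lrCrossingAt _ _ _) (isUpperSet_lrCrossingAt _ _ _)
          (measurableSet_lrCrossingAt _ _ _) (measurableSet_lrCrossingAt _ _ _)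
          (le_real_lrCrossingAt_of_rsw hc _ (by omega)) (le_real_lrCrossingAt_of_rsw hc _ (by omega)))
        (le_real_lrCrossingAt_of_rsw hc _ (by omega))
  have hBm : c ^ 4 * (1 / 2 : ℝ) ^ (2 * (k / 64 + 1)) ≤ μ.real (uCorrDual k N SB NT) := by
    have e4 : c ^ 4 * (1 / 2 : ℝ) ^ (2 * (k / 64 + 1)) =
        c * c * (c * (1 / 2 : ℝ) ^ (k / 64 + 1) * (c * (1 / 2 : ℝ) ^ (k / 64 + 1))) := by ring
    rw [e4]
    refine le_real_inter_of_lower (by positivity) (by positivity)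
      ((isLowerSet_dualFaceCrossing _ _ _).inter (isLowerSet_dualFaceCrossing _ _ _))
      (((isLowerSet_dualFaceCrossing _ _ _).inter (isLowerSet_rowClosed _ _ _)).inter
        ((isLowerSet_dualFaceCrossing _ _ _).inter (isLowerSet_rowClosed _ _ _)))
      ((measurableSet_dualFaceCrossing _ _ _).inter (measurableSet_dualFaceCrossing _ _ _))
      (((measurableSet_dualFaceCrossing _ _ _).inter (measurableSet_forall_notMem _)).inter
        ((measurableSet_dualFaceCrossing _ _ _).inter (measurableSet_forall_notMem _)))
      (le_real_inter_of_lower hc0' hc0' (isLowerSet_dualFaceCrossing _ _ _) (isLowerSet_dualFaceCrossing _ _ _)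
        (measurableSet_dualFaceCrossing _ _ _) (measurableSet_dualFaceCrossing _ _ _)
        (le_real_dualFaceCrossing_of_rsw hc _ (by omega)) (le_real_dualFaceCrossing_of_rsw hc _ (by omega)))
      ?_
    refine le_real_inter_of_lower (by positivity) (by positivity)
      ((isLowerSet_dualFaceCrossing _ _ _).inter (isLowerSet_rowClosed _ _ _))
      ((isLowerSet_dualFaceCrossing _ _ _).inter (isLowerSet_rowClosed _ _ _))
      ((measurableSet_dualFaceCrossing _ _ _).inter (measurableSet_forall_notMem _))
      ((measurableSet_dualFaceCrossing _ _ _).inter (measurableSet_forall_notMem _)) ?_ ?_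
    · exact le_real_inter_of_lower hc0' (by positivity) (isLowerSet_dualFaceCrossing _ _ _) (isLowerSet_rowClosed _ _ _)
        (measurableSet_dualFaceCrossing _ _ _) (measurableSet_forall_notMem _)
        (le_real_dualFaceCrossing_of_rsw hc _ (by omega)) (le_real_rowClosed _ _ _)
    · exact le_real_inter_of_lower hc0' (by positivity) (isLowerSet_dualFaceCrossing _ _ _) (isLowerSet_rowClosed _ _ _)
        (measurableSet_dualFaceCrossing _ _ _) (measurableSet_forall_notMem _)
        (le_real_dualFaceCrossing_of_rsw hc _ (by omega)) (le_real_rowClosed _ _ _)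
  have hHub := le_real_zdHub (k / 2 - 1) (k / 4) (k / 64)
  -- assembly
  have hset : uGlued k N WL ER SB NT =
      zdSepOpenPairR k N ∩ zdSepOpenArmL k N ∩ (zdSepDualArmT k N ∩ zdSepDualArmB k N) ∩
        (uCorrOpen k N WL ER ∩ uCorrDual k N SB NT) ∩ zdHub (k / 2 - 1) (k / 4) (k / 64) := rfl
  have hsep : zdFiveArmSep k N = zdSepOpenPairR k N ∩ zdSepOpenArmL k N ∩ (zdSepDualArmT k N ∩ zdSepDualArmB k N) := rfl
  rw [hset, hind, hsep]
  calc c ^ 10 * (1 / 2 : ℝ) ^ (2 * (k / 64 + 1)) * (1 / 2 : ℝ) ^ (hubPairs (k / 2 - 1)).card *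
        μ.real (zdSepOpenPairR k N ∩ zdSepOpenArmL k N ∩ (zdSepDualArmT k N ∩ zdSepDualArmB k N))
      = μ.real (zdSepOpenPairR k N ∩ zdSepOpenArmL k N ∩ (zdSepDualArmT k N ∩ zdSepDualArmB k N)) *
          (c ^ 6 * (c ^ 4 * (1 / 2 : ℝ) ^ (2 * (k / 64 + 1)))) * (1 / 2 : ℝ) ^ (hubPairs (k / 2 - 1)).card := by ring
    _ ≤ μ.real (zdSepOpenPairR k N ∩ zdSepOpenArmL k N ∩ (zdSepDualArmT k N ∩ zdSepDualArmB k N)) *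
          (μ.real (uCorrOpen k N WL ER) * μ.real (uCorrDual k N SB NT)) * μ.real (zdHub (k / 2 - 1) (k / 4) (k / 64)) := by
        refine mul_le_mul (mul_le_mul_of_nonneg_left (mul_le_mul hBp hBm (by positivity) measureReal_nonneg)
          measureReal_nonneg) hHub (by positivity) (by positivity)
    _ ≤ _ := mul_le_mul_of_nonneg_right hFKG measureReal_nonneg

end UProbability

/-! ### Coordinates of the pieces of the fenced arms -/

section PieceCoords

variable {ω : BondConfig (Site 2)} {n N : ℕ} {lo hi lo' hi' : ℤ}

/-- **Sign-aware localisation of a fenced right arm**: a carrier site is in the annulus, or to the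
right of the column `N - N/8` with height strictly within `N/8` of the outer landing interval,
or in the columns `[n - n/8, n + n/8 - 1]` with height strictly within `n/8` of the inner landing
interval (`N, n ≥ 8`). [folklore] -/
theorem ZdSepOpenArmR.carrier_cases (A : ZdSepOpenArmR ω n N lo hi lo' hi') (hn : 8 ≤ n) (hN : 8 ≤ N)
    {v : Site 2} (hv : v ∈ A.carrier) :
    v ∈ sqAnnulus n N ∨
      ((N : ℤ) + 1 - (N / 8 : ℕ) ≤ v 0 ∧ lo' - (N / 8 : ℕ) < v 1 ∧ v 1 < hi' + (N / 8 : ℕ)) ∨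
      ((n : ℤ) - (n / 8 : ℕ) ≤ v 0 ∧ v 0 + 1 ≤ n + (n / 8 : ℕ) ∧ lo - (n / 8 : ℕ) < v 1 ∧ v 1 < hi + (n / 8 : ℕ)) := by
  have hz := A.hz
  have hx := A.hx
  have hHE : (N / 64 : ℕ) < (N / 8 : ℕ) := by omega
  have hhe : (n / 64 : ℕ) < (n / 8 : ℕ) := by omega
  rcases hv with hv | hv | hv | hv | hv
  · exact Or.inl (A.hW v hv)
  · right; left
    obtain ⟨h1, -, h3⟩ := A.hV v hv
    have := abs_le.1 h3
    exact ⟨by omega, by omega, by omega⟩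
  · right; left
    obtain ⟨h1, h2⟩ := A.hP v hv
    have e1 := abs_le.1 (show |v 0 - A.z 0| ≤ (N / 8 : ℕ) - 1 by omega)
    have e2 := abs_le.1 (show |v 1 - A.z 1| ≤ (N / 8 : ℕ) - 1 by omega)
    exact ⟨by omega, by omega, by omega⟩
  · right; right
    obtain ⟨h1, h2, h3⟩ := A.hV' v hv
    have := abs_le.1 h3
    exact ⟨by omega, by omega, by omega, by omega⟩
  · right; right
    obtain ⟨h1, h2⟩ := A.hP' v hv
    have e1 := abs_le.1 (show |v 0 - A.x 0| ≤ (n / 8 : ℕ) - 1 by omega)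
    have e2 := abs_le.1 (show |v 1 - A.x 1| ≤ (n / 8 : ℕ) - 1 by omega)
    exact ⟨by omega, by omega, by omega, by omega⟩

/-- **Sign-aware localisation of a fenced left arm** (mirror image). [folklore] -/
theorem ZdSepOpenArmL.carrier_cases (A : ZdSepOpenArmL ω n N lo hi lo' hi') (hn : 8 ≤ n) (hN : 8 ≤ N)
    {v : Site 2} (hv : v ∈ A.carrier) :
    v ∈ sqAnnulus n N ∨
      (v 0 + 1 ≤ -(N : ℤ) + (N / 8 : ℕ) ∧ lo' - (N / 8 : ℕ) < v 1 ∧ v 1 < hi' + (N / 8 : ℕ)) ∨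
      (-(n : ℤ) - (n / 8 : ℕ) + 1 ≤ v 0 ∧ v 0 ≤ -(n : ℤ) + (n / 8 : ℕ) ∧ lo - (n / 8 : ℕ) < v 1 ∧ v 1 < hi + (n / 8 : ℕ)) := by
  have hz := A.hz
  have hx := A.hx
  have hHE : (N / 64 : ℕ) < (N / 8 : ℕ) := by omega
  have hhe : (n / 64 : ℕ) < (n / 8 : ℕ) := by omega
  rcases hv with hv | hv | hv | hv | hv
  · exact Or.inl (A.hW v hv)
  · right; left
    obtain ⟨-, h2, h3⟩ := A.hV v hv
    have := abs_le.1 h3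
    exact ⟨by omega, by omega, by omega⟩
  · right; left
    obtain ⟨h1, h2⟩ := A.hP v hv
    have e1 := abs_le.1 (show |v 0 - A.z 0| ≤ (N / 8 : ℕ) - 1 by omega)
    have e2 := abs_le.1 (show |v 1 - A.z 1| ≤ (N / 8 : ℕ) - 1 by omega)
    exact ⟨by omega, by omega, by omega⟩
  · right; right
    obtain ⟨h1, h2, h3⟩ := A.hV' v hv
    have := abs_le.1 h3
    exact ⟨by omega, by omega, by omega, by omega⟩
  · right; right
    obtain ⟨h1, h2⟩ := A.hP' v hv
    have e1 := abs_le.1 (show |v 0 - A.x 0| ≤ (n / 8 : ℕ) - 1 by omega)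
    have e2 := abs_le.1 (show |v 1 - A.x 1| ≤ (n / 8 : ℕ) - 1 by omega)
    exact ⟨by omega, by omega, by omega, by omega⟩

/-- A vertex of a walk is its start or the head of one of its darts. [folklore] -/
theorem eq_or_exists_dart_snd {V : Type*} {G : SimpleGraph V} {u v : V} (p : G.Walk u v) {z : V}
    (hz : z ∈ p.support) : z = u ∨ ∃ d ∈ p.darts, z = d.snd := by
  induction p with
  | nil => left; simpa using hz
  | cons h p ih =>
    rw [Walk.support_cons, List.mem_cons] at hz
    rcases hz with rfl | hz
    · exact Or.inl rfl
    · right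
      rcases ih hz with rfl | ⟨d, hd, rfl⟩
      · exact ⟨⟨(_, _), h⟩, by simp [Walk.darts_cons], rfl⟩
      · exact ⟨d, by simp [Walk.darts_cons, hd], rfl⟩

/-- The head face of a step whose crossed edge lies in the box `B(N)` has coordinates in
`[-N-2, N]`. [folklore] -/
theorem dart_snd_bounds_of_sepEdge {N : ℕ} {d : (zdGraph 2).Dart}
    (h : ∀ v ∈ sepEdge d.fst d.snd, v ∈ box 2 N) :
    -(N : ℤ) - 2 ≤ d.snd 0 ∧ d.snd 0 ≤ N ∧ -(N : ℤ) - 2 ≤ d.snd 1 ∧ d.snd 1 ≤ N := by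
  have hle := zdGraph_adj_apply_le d.adj
  have hmem : sepLo d.fst d.snd ∈ sepEdge d.fst d.snd := by rw [sepEdge]; exact Sym2.mem_mk_left _ _
  have hb := h _ hmem
  rw [mem_box, Fin.forall_fin_two] at hb
  obtain ⟨⟨h0, h0'⟩, ⟨h1, h1'⟩⟩ := sepEdge_apply_le hmem
  have a0 := hle 0
  have a1 := hle 1
  refine ⟨?_, ?_, ?_, ?_⟩
  · have : max (d.fst 0) (d.snd 0) ≤ d.snd 0 + 1 := max_le (by omega) (by omega); omega
  · have : d.snd 0 ≤ max (d.fst 0) (d.snd 0) := le_max_right _ _; omega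
  · have : max (d.fst 1) (d.snd 1) ≤ d.snd 1 + 1 := max_le (by omega) (by omega); omega
  · have : d.snd 1 ≤ max (d.fst 1) (d.snd 1) := le_max_right _ _; omega

/-- **Coordinates of the faces of a fenced top dual arm**: every face of the body, the attaching
walks and the fence crossings has `|f₀| ≤ N + N/8` and `-N - 2 ≤ f₁ ≤ N + N/8`, provided the
landing columns lie in `[-N, N]` and `1 ≤ n ≤ N`. [folklore] -/
theorem ZdSepDualArmT.face_bounds (A : ZdSepDualArmT ω n N lo hi lo' hi') (hn : 1 ≤ n) (hnN : n ≤ N)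
    (hlo : -(N : ℤ) ≤ lo) (hhi : hi ≤ N) (hlo' : -(N : ℤ) ≤ lo') (hhi' : hi' ≤ N) {z : Site 2}
    (hz : (z ∈ A.Q.support ∨ z ∈ A.P.support ∨ z ∈ A.C.support) ∨ (z ∈ A.P'.support ∨ z ∈ A.C'.support)) :
    |z 0| ≤ (N : ℤ) + (N / 8 : ℕ) + 2 ∧ -(N : ℤ) - (N / 8 : ℕ) - 2 ≤ z 1 ∧ z 1 ≤ (N : ℤ) + (N / 8 : ℕ) + 2 := by
  have hf := A.hf
  have hg := A.hg
  rcases hz with (hz | hz | hz) | (hz | hz)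
  · rcases eq_or_exists_dart_snd A.Q hz with rfl | ⟨d, hd, rfl⟩
    · exact ⟨abs_le.2 ⟨by omega, by omega⟩, by omega, by omega⟩
    · have hb := dart_snd_bounds_of_sepEdge (N := N) fun v hv => by
        have := A.hQa d hd v hv
        rw [sqAnnulus, Finset.mem_coe, mem_annulus] at this
        exact this.1
      exact ⟨abs_le.2 ⟨by omega, by omega⟩, by omega, by omega⟩
  · obtain ⟨h1, h2⟩ := A.hP z hz
    have e1 := abs_le.1 (show |z 0 - A.g 0| ≤ (N / 8 : ℕ) - 1 by omega)
    have e2 := abs_le.1 (show |z 1 - A.g 1| ≤ (N / 8 : ℕ) - 1 by omega)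
    exact ⟨abs_le.2 ⟨by omega, by omega⟩, by omega, by omega⟩
  · obtain ⟨h1, h2, h3⟩ := A.hC z hz
    have e1 := abs_le.1 h1
    have : (N / 64 : ℕ) ≤ (N / 8 : ℕ) := Nat.div_le_div_left (by norm_num) (by norm_num)
    exact ⟨abs_le.2 ⟨by omega, by omega⟩, by omega, by omega⟩
  · obtain ⟨h1, h2⟩ := A.hP' z hz
    have e1 := abs_le.1 (show |z 0 - A.f 0| ≤ (n / 8 : ℕ) - 1 by omega)
    have e2 := abs_le.1 (show |z 1 - A.f 1| ≤ (n / 8 : ℕ) - 1 by omega)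
    have : (n / 8 : ℕ) ≤ (N / 8 : ℕ) := Nat.div_le_div_right hnN
    exact ⟨abs_le.2 ⟨by omega, by omega⟩, by omega, by omega⟩
  · obtain ⟨h1, h2, h3⟩ := A.hC' z hz
    have e1 := abs_le.1 h1
    have : (n / 64 : ℕ) ≤ (N / 8 : ℕ) := (Nat.div_le_div_left (by norm_num) (by norm_num)).trans (Nat.div_le_div_right hnN)
    exact ⟨abs_le.2 ⟨by omega, by omega⟩, by omega, by omega⟩

/-- **Coordinates of the faces of a fenced bottom dual arm** (mirror image). [folklore] -/
theorem ZdSepDualArmB.face_bounds (A : ZdSepDualArmB ω n N lo hi lo' hi') (hn : 1 ≤ n) (hnN : n ≤ N)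
    (hlo : -(N : ℤ) ≤ lo) (hhi : hi ≤ N) (hlo' : -(N : ℤ) ≤ lo') (hhi' : hi' ≤ N) {z : Site 2}
    (hz : (z ∈ A.Q.support ∨ z ∈ A.P.support ∨ z ∈ A.C.support) ∨ (z ∈ A.P'.support ∨ z ∈ A.C'.support)) :
    |z 0| ≤ (N : ℤ) + (N / 8 : ℕ) + 2 ∧ -(N : ℤ) - (N / 8 : ℕ) - 2 ≤ z 1 ∧ z 1 ≤ (N : ℤ) + (N / 8 : ℕ) + 2 := by
  have hf := A.hf
  have hg := A.hg
  rcases hz with (hz | hz | hz) | (hz | hz)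
  · rcases eq_or_exists_dart_snd A.Q hz with rfl | ⟨d, hd, rfl⟩
    · exact ⟨abs_le.2 ⟨by omega, by omega⟩, by omega, by omega⟩
    · have hb := dart_snd_bounds_of_sepEdge (N := N) fun v hv => by
        have := A.hQa d hd v hv
        rw [sqAnnulus, Finset.mem_coe, mem_annulus] at this
        exact this.1
      exact ⟨abs_le.2 ⟨by omega, by omega⟩, by omega, by omega⟩
  · obtain ⟨h1, h2⟩ := A.hP z hz
    have e1 := abs_le.1 (show |z 0 - A.g 0| ≤ (N / 8 : ℕ) - 1 by omega)
    have e2 := abs_le.1 (show |z 1 - A.g 1| ≤ (N / 8 : ℕ) - 1 by omega)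
    exact ⟨abs_le.2 ⟨by omega, by omega⟩, by omega, by omega⟩
  · obtain ⟨h1, h2, h3⟩ := A.hC z hz
    have e1 := abs_le.1 h1
    have : (N / 64 : ℕ) ≤ (N / 8 : ℕ) := Nat.div_le_div_left (by norm_num) (by norm_num)
    exact ⟨abs_le.2 ⟨by omega, by omega⟩, by omega, by omega⟩
  · obtain ⟨h1, h2⟩ := A.hP' z hz
    have e1 := abs_le.1 (show |z 0 - A.f 0| ≤ (n / 8 : ℕ) - 1 by omega)
    have e2 := abs_le.1 (show |z 1 - A.f 1| ≤ (n / 8 : ℕ) - 1 by omega)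
    have : (n / 8 : ℕ) ≤ (N / 8 : ℕ) := Nat.div_le_div_right hnN
    exact ⟨abs_le.2 ⟨by omega, by omega⟩, by omega, by omega⟩
  · obtain ⟨h1, h2, h3⟩ := A.hC' z hz
    have e1 := abs_le.1 h1
    have : (n / 64 : ℕ) ≤ (N / 8 : ℕ) := (Nat.div_le_div_left (by norm_num) (by norm_num)).trans (Nat.div_le_div_right hnN)
    have : (n / 8 : ℕ) ≤ (N / 8 : ℕ) := Nat.div_le_div_right hnN
    exact ⟨abs_le.2 ⟨by omega, by omega⟩, by omega, by omega⟩

end PieceCoords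

/-! ### Translation of walks -/

section Shift

/-- `(zdShiftIso v).toHom x = x + v` (`zdShiftIso` of `SiteConnectionTools.lean`). [folklore] -/
@[simp] theorem zdShiftIso_toHom_apply (v x : Site 2) : (zdShiftIso v).toHom x = x + v := rfl

variable {v a b : Site 2}

/-- Vertices of a translated walk. [folklore] -/
theorem mem_support_map_shift {p : (zdGraph 2).Walk a b} {z : Site 2} :
    z ∈ (p.map (zdShiftIso v).toHom).support ↔ z - v ∈ p.support := by
  rw [Walk.support_map, List.mem_map]
  constructor
  · rintro ⟨w, hw, rfl⟩; simpa using hw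
  · intro h; exact ⟨z - v, h, by simp⟩

/-- Edges of a translated walk. [folklore] -/
theorem mem_edges_map_shift {p : (zdGraph 2).Walk a b} {e : Sym2 (Site 2)}
    (he : e ∈ (p.map (zdShiftIso v).toHom).edges) : ∃ e' ∈ p.edges, e = Sym2.map (· + v) e' := by
  rw [Walk.edges_map, List.mem_map] at he
  obtain ⟨e', he', rfl⟩ := he
  exact ⟨e', he', rfl⟩

/-- Darts of a translated walk. [folklore] -/
theorem mem_darts_map_shift {p : (zdGraph 2).Walk a b} {d : (zdGraph 2).Dart}
    (hd : d ∈ (p.map (zdShiftIso v).toHom).darts) : ∃ d' ∈ p.darts, d.fst = d'.fst + v ∧ d.snd = d'.snd + v := by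
  rw [Walk.darts_map, List.mem_map] at hd
  obtain ⟨d', hd', rfl⟩ := hd
  exact ⟨d', hd', rfl, rfl⟩

/-- A shifted pair in a shifted configuration. [folklore] -/
theorem map_add_mem_relabel_shift_iff (v : Site 2) (ω : BondConfig (Site 2)) (e : Sym2 (Site 2)) :
    Sym2.map (· + v) e ∈ BondConfig.relabel (sym2Equiv (Site.shift v)) ω ↔ e ∈ ω := by
  induction e using Sym2.ind with
  | h x y => rw [Sym2.map_mk]; exact mk_add_mem_relabel_shift_iff v ω x y

/-- Faces around the origin translate to faces around `v`. [folklore] -/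
theorem add_mem_cornerFaces {z : Site 2} (hz : z ∈ cornerFaces 0) (v : Site 2) : z + v ∈ cornerFaces v := by
  rw [mem_cornerFaces_iff] at hz ⊢
  simp only [Pi.add_apply, Pi.zero_apply] at hz ⊢
  omega

end Shift

/-! ### The open arms of `(U)` in the hub frame -/

section UOpenArms

/-- Gluing lemmas with general landing parameters (re-typed). [folklore] -/
theorem ZdSepOpenArmR.exists_walk_of_outerCorridor' {ω : BondConfig (Site 2)} {n N : ℕ} {lo hi lo' hi' : ℤ}
    {s y : Site 2} (A : ZdSepOpenArmR ω n N lo hi lo' hi') (hhi' : hi' = lo' + (N / 64 : ℕ))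
    (hE : 1 ≤ N / 8) (T : (zdGraph 2).Walk s y) (hs : s 0 = N + 1) (hy : (N : ℤ) + (N / 8 : ℕ) ≤ y 0)
    (hT : ∀ z ∈ T.support, (N : ℤ) + 1 ≤ z 0 ∧ (z 0 ≤ N + (N / 8 : ℕ) → lo' ≤ z 1 ∧ z 1 ≤ lo' + (N / 64 : ℕ))) :
    ∃ m ∈ T.support, ∃ U : (zdGraph 2).Walk A.x m,
      (∀ z ∈ U.support, z ∈ A.carrier) ∧ ∀ e ∈ U.edges, e ∈ ω := by
  subst hhi'; exact A.exists_walk_of_outerCorridor hE T hs hy hT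

/-- Inner gluing, right arm, with general landing parameters (re-typed). [folklore] -/
theorem ZdSepOpenArmR.exists_walk_of_innerCorridor' {ω : BondConfig (Site 2)} {n N : ℕ} {lo hi lo' hi' : ℤ}
    {s y : Site 2} (A : ZdSepOpenArmR ω n N lo hi lo' hi') (hhi : hi = lo + (n / 64 : ℕ))
    (he : 1 ≤ n / 8) (T : (zdGraph 2).Walk s y) (hy : y 0 + 1 = n) (hs : s 0 ≤ (n : ℤ) - (n / 8 : ℕ))
    (hT : ∀ z ∈ T.support, z 0 + 1 ≤ n ∧ ((n : ℤ) - (n / 8 : ℕ) ≤ z 0 → lo ≤ z 1 ∧ z 1 ≤ lo + (n / 64 : ℕ))) :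
    ∃ m ∈ T.support, ∃ U : (zdGraph 2).Walk A.x m,
      (∀ z ∈ U.support, z ∈ A.carrier) ∧ ∀ e ∈ U.edges, e ∈ ω := by
  subst hhi; exact A.exists_walk_of_innerCorridor he T hy hs hT

/-- Outer gluing, left arm, with general landing parameters (re-typed). [folklore] -/
theorem ZdSepOpenArmL.exists_walk_of_outerCorridor' {ω : BondConfig (Site 2)} {n N : ℕ} {lo hi lo' hi' : ℤ}
    {s y : Site 2} (A : ZdSepOpenArmL ω n N lo hi lo' hi') (hhi' : hi' = lo' + (N / 64 : ℕ))
    (hE : 1 ≤ N / 8) (T : (zdGraph 2).Walk s y) (hs : s 0 = -(N : ℤ) - 1) (hy : y 0 ≤ -(N : ℤ) - (N / 8 : ℕ))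
    (hT : ∀ z ∈ T.support, z 0 ≤ -(N : ℤ) - 1 ∧ (-(N : ℤ) - (N / 8 : ℕ) ≤ z 0 → lo' ≤ z 1 ∧ z 1 ≤ lo' + (N / 64 : ℕ))) :
    ∃ m ∈ T.support, ∃ U : (zdGraph 2).Walk A.x m,
      (∀ z ∈ U.support, z ∈ A.carrier) ∧ ∀ e ∈ U.edges, e ∈ ω := by
  subst hhi'; exact A.exists_walk_of_outerCorridor hE T hs hy hT

/-- Inner gluing, left arm, with general landing parameters (re-typed). [folklore] -/
theorem ZdSepOpenArmL.exists_walk_of_innerCorridor' {ω : BondConfig (Site 2)} {n N : ℕ} {lo hi lo' hi' : ℤ}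
    {s y : Site 2} (A : ZdSepOpenArmL ω n N lo hi lo' hi') (hhi : hi = lo + (n / 64 : ℕ))
    (he : 1 ≤ n / 8) (T : (zdGraph 2).Walk s y) (hy : y 0 = -(n : ℤ) + 1) (hs : -(n : ℤ) + (n / 8 : ℕ) ≤ s 0)
    (hT : ∀ z ∈ T.support, -(n : ℤ) + 1 ≤ z 0 ∧ (z 0 ≤ -(n : ℤ) + (n / 8 : ℕ) → lo ≤ z 1 ∧ z 1 ≤ lo + (n / 64 : ℕ))) :
    ∃ m ∈ T.support, ∃ U : (zdGraph 2).Walk A.x m,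
      (∀ z ∈ U.support, z ∈ A.carrier) ∧ ∀ e ∈ U.edges, e ∈ ω := by
  subst hhi; exact A.exists_walk_of_innerCorridor he T hy hs hT

/-- **Composition of an extended arm**: hub walk, inner corridor up to its meeting point with the
inner gluing walk, inner gluing walk (reversed), outer gluing walk, outer corridor from its meeting
point on. [folklore] -/
theorem exists_composedArm {ω : BondConfig (Site 2)} {c tip yi x mi mo so yo : Site 2}
    (HW : (zdGraph 2).Walk c tip) (Ti : (zdGraph 2).Walk tip yi) (hmi : mi ∈ Ti.support)
    (Ui : (zdGraph 2).Walk x mi) (Uo : (zdGraph 2).Walk x mo) (To : (zdGraph 2).Walk so yo) (hmo : mo ∈ To.support)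
    (h1 : ∀ e ∈ HW.edges, e ∈ ω) (h2 : ∀ e ∈ Ti.edges, e ∈ ω) (h3 : ∀ e ∈ Ui.edges, e ∈ ω)
    (h4 : ∀ e ∈ Uo.edges, e ∈ ω) (h5 : ∀ e ∈ To.edges, e ∈ ω) :
    ∃ P : (zdGraph 2).Walk c yo, (∀ e ∈ P.edges, e ∈ ω) ∧
      ∀ z ∈ P.support, z ∈ HW.support ∨ z ∈ Ti.support ∨ z ∈ Ui.support ∨ z ∈ Uo.support ∨ z ∈ To.support := by
  refine ⟨HW.append ((Ti.takeUntil mi hmi).append (Ui.reverse.append (Uo.append (To.dropUntil mo hmo)))),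
    fun e he => ?_, fun z hz => ?_⟩
  · simp only [Walk.edges_append, List.mem_append, Walk.edges_reverse, List.mem_reverse] at he
    rcases he with he | he | he | he | he
    · exact h1 e he
    · exact h2 e (Ti.edges_takeUntil_subset_edges hmi he)
    · exact h3 e he
    · exact h4 e he
    · exact h5 e (To.edges_dropUntil_subset_edges hmo he)
  · simp only [Walk.mem_support_append_iff, Walk.support_reverse, List.mem_reverse] at hz
    rcases hz with hz | hz | hz | hz | hz
    · exact Or.inl hz
    · exact Or.inr (Or.inl (Ti.support_takeUntil_subset_support hmi hz))
    · exact Or.inr (Or.inr (Or.inl hz))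
    · exact Or.inr (Or.inr (Or.inr (Or.inl hz)))
    · exact Or.inr (Or.inr (Or.inr (Or.inr (To.support_dropUntil_subset_support hmo hz))))

variable {k N WL ER SB NT : ℕ}

/-- **The three extended open arms of `(U)`** (hub frame): on `uGlued`, for lattice
configurations, three open walks from the origin to the left side `{x₀ = -WL}` and (twice) to the
right side `{x₀ = ER}` of the target rectangle, inside the slab `{-WL ≤ x₀ ≤ ER, |x₁| ≤ 3N}`, the
two right ones vertex-disjoint off the origin. [cite: Nolin2008, §4.5, proof of Prop. 17; KestenSidoraviciusZhang1998, (3.10)] -/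
theorem uGlued_openArms (hk : 128 ≤ k) (hN : 2 * k ≤ N) (hWL : 3 * N ≤ WL) (hER : 3 * N ≤ ER)
    {ω : BondConfig (Site 2)} (hωE : ω ⊆ (zdGraph 2).edgeSet) (hω : ω ∈ uGlued k N WL ER SB NT) :
    ∃ (l r r' : Site 2) (P₁ : (zdGraph 2).Walk 0 l) (P₃ : (zdGraph 2).Walk 0 r) (P₄ : (zdGraph 2).Walk 0 r'),
      l 0 = -(WL : ℤ) ∧ r 0 = ER ∧ r' 0 = ER ∧
      (∀ z ∈ P₁.support, -(WL : ℤ) ≤ z 0 ∧ z 0 ≤ ER ∧ |z 1| ≤ 3 * N) ∧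
      (∀ z ∈ P₃.support, -(WL : ℤ) ≤ z 0 ∧ z 0 ≤ ER ∧ |z 1| ≤ 3 * N) ∧
      (∀ z ∈ P₄.support, -(WL : ℤ) ≤ z 0 ∧ z 0 ≤ ER ∧ |z 1| ≤ 3 * N) ∧
      (∀ e ∈ P₁.edges, e ∈ ω) ∧ (∀ e ∈ P₃.edges, e ∈ ω) ∧ (∀ e ∈ P₄.edges, e ∈ ω) ∧
      (∀ z ∈ P₃.support, z ∈ P₄.support → z = 0) := by
  obtain ⟨⟨⟨⟨⟨Ap, Am, hdisj⟩, ⟨AL⟩⟩, -, -⟩, ⟨⟨⟨hORp, hORm⟩, hOL⟩, ⟨⟨hIRp, hIRm⟩, hIL⟩⟩, -⟩, hHub⟩ := hω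
  have hk8 : 8 ≤ k := by omega
  have hN8 : 8 ≤ N := by omega
  have hE : 1 ≤ N / 8 := by omega
  have he : 1 ≤ k / 8 := by omega
  have hKa : k / 4 + k / 64 ≤ k / 2 - 1 := by omega
  have hK1 : (((k / 2 - 1 : ℕ) : ℤ)) = (k / 2 : ℕ) - 1 := by omega
  -- zone bounds for carrier sites
  have zoneR_bd : ∀ z ∈ zdSepZoneR k N, |z 0| ≤ (N : ℤ) + (N / 8 : ℕ) + 1 ∧ |z 1| ≤ (N : ℤ) + (N / 8 : ℕ) + 1 :=
    fun z hz => (zone_sites hk hN (Or.inl (Or.inl hz))).1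
  have zoneL_bd : ∀ z ∈ zdSepZoneL k N, |z 0| ≤ (N : ℤ) + (N / 8 : ℕ) + 1 ∧ |z 1| ≤ (N : ℤ) + (N / 8 : ℕ) + 1 :=
    fun z hz => (zone_sites hk hN (Or.inl (Or.inr hz))).1
  have hApZ : Ap.carrier ⊆ zdSepZoneR k N := by
    intro v hv
    rcases Ap.carrier_subset (B := (k / 4 : ℕ) + (k / 64 : ℕ)) (B' := (N / 4 : ℕ) + (N / 64 : ℕ))
      (abs_le.2 ⟨by omega, by omega⟩) (abs_le.2 ⟨by omega, by omega⟩) (abs_le.2 ⟨by omega, by omega⟩)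
      (abs_le.2 ⟨by omega, by omega⟩) hv with h | h | h
    · exact Or.inl h
    · exact Or.inr (Or.inl ⟨h.1, h.2.1, by have := h.2.2; omega⟩)
    · exact Or.inr (Or.inr ⟨h.1, h.2.1, by have := h.2.2; omega⟩)
  have hAmZ : Am.carrier ⊆ zdSepZoneR k N := by
    intro v hv
    rcases Am.carrier_subset (B := (k / 4 : ℕ) + (k / 64 : ℕ)) (B' := (N / 4 : ℕ) + (N / 64 : ℕ))
      (abs_le.2 ⟨by omega, by omega⟩) (abs_le.2 ⟨by omega, by omega⟩) (abs_le.2 ⟨by omega, by omega⟩)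
      (abs_le.2 ⟨by omega, by omega⟩) hv with h | h | h
    · exact Or.inl h
    · exact Or.inr (Or.inl ⟨h.1, h.2.1, by have := h.2.2; omega⟩)
    · exact Or.inr (Or.inr ⟨h.1, h.2.1, by have := h.2.2; omega⟩)
  have hALZ : AL.carrier ⊆ zdSepZoneL k N := by
    intro v hv
    rcases AL.carrier_subset (B := (k / 64 : ℕ)) (B' := (N / 64 : ℕ)) (abs_le.2 ⟨by omega, by omega⟩)
      (abs_le.2 ⟨by omega, by omega⟩) (abs_le.2 ⟨by omega, by omega⟩) (abs_le.2 ⟨by omega, by omega⟩) hv with h | h | h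
    · exact Or.inl h
    · exact Or.inr (Or.inl ⟨h.1, h.2.1, by have := h.2.2; omega⟩)
    · exact Or.inr (Or.inr ⟨h.1, h.2.1, by have := h.2.2; omega⟩)
  -- ### the upper right arm
  obtain ⟨xo, yo, To, hxo, hyo, hTos, hToe⟩ := exists_walk_of_mem_lrCrossingAt hωE hORp
  obtain ⟨xi, yi, Ti, hxi, hyi, hTis, hTie⟩ := exists_walk_of_mem_lrCrossingAt hωE hIRp
  simp only [Matrix.cons_val_zero, Matrix.cons_val_one] at hxo hyo hTos hxi hyi hTis
  obtain ⟨mo, hmo, Uo, hUos, hUoe⟩ := Ap.exists_walk_of_outerCorridor' rfl hE To hxo (by rw [hyo]; omega)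
    (fun z hz => ⟨(hTos z hz).1, fun _ => ⟨(hTos z hz).2.2.1, (hTos z hz).2.2.2⟩⟩)
  obtain ⟨mi, hmi, Ui, hUis, hUie⟩ := Ap.exists_walk_of_innerCorridor' rfl he Ti (by rw [hyi]; omega) (by rw [hxi]; omega)
    (fun z hz => ⟨by have := (hTis z hz).2.1; omega, fun _ => ⟨(hTis z hz).2.2.1, (hTis z hz).2.2.2⟩⟩)
  have hxi1 := (hTis xi Ti.start_mem_support).2.2
  obtain ⟨tip, HW, htip0, htip1, hHWs, hHWe⟩ := exists_hubWalkRpos (k / 2 - 1) (k / 4) (k / 64) (t := xi 1) hxi1.1 hxi1.2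
  obtain rfl : tip = xi := LatticeModels.Site.eq_iff_two.2 ⟨by rw [htip0, hxi]; omega, htip1⟩
  obtain ⟨P₃, hP₃e, hP₃s⟩ := exists_composedArm HW Ti hmi Ui Uo To hmo
    (fun e he' => mem_of_mem_zdHub_of_mem_hubOpen hKa hHub (hHWe e he')) hTie hUie hUoe hToe
  -- ### the lower right arm
  obtain ⟨xo', yo', To', hxo', hyo', hTos', hToe'⟩ := exists_walk_of_mem_lrCrossingAt hωE hORm
  obtain ⟨xi', yi', Ti', hxi', hyi', hTis', hTie'⟩ := exists_walk_of_mem_lrCrossingAt hωE hIRm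
  simp only [Matrix.cons_val_zero, Matrix.cons_val_one] at hxo' hyo' hTos' hxi' hyi' hTis'
  obtain ⟨mo', hmo', Uo', hUos', hUoe'⟩ := Am.exists_walk_of_outerCorridor' (by omega) hE To' hxo'
    (by rw [hyo']; omega) (fun z hz => ⟨(hTos' z hz).1, fun _ => ⟨(hTos' z hz).2.2.1, by have := (hTos' z hz).2.2.2; omega⟩⟩)
  obtain ⟨mi', hmi', Ui', hUis', hUie'⟩ := Am.exists_walk_of_innerCorridor' (by omega) he Ti'
    (by rw [hyi']; omega) (by rw [hxi']; omega)
    (fun z hz => ⟨by have := (hTis' z hz).2.1; omega, fun _ => ⟨(hTis' z hz).2.2.1, by have := (hTis' z hz).2.2.2; omega⟩⟩)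
  have hxi1' := (hTis' xi' Ti'.start_mem_support).2.2
  obtain ⟨tip', HW', htip0', htip1', hHWs', hHWe'⟩ := exists_hubWalkRneg (k / 2 - 1) (k / 4) (k / 64) (t := xi' 1)
    (by have := hxi1'.1; omega) (by have := hxi1'.2; omega)
  obtain rfl : tip' = xi' := LatticeModels.Site.eq_iff_two.2 ⟨by rw [htip0', hxi']; omega, htip1'⟩
  obtain ⟨P₄, hP₄e, hP₄s⟩ := exists_composedArm HW' Ti' hmi' Ui' Uo' To' hmo'
    (fun e he' => mem_of_mem_zdHub_of_mem_hubOpen hKa hHub (hHWe' e he')) hTie' hUie' hUoe' hToe'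
  -- ### the left arm
  obtain ⟨xl, yl, Tl, hxl, hyl, hTls, hTle⟩ := exists_walk_of_mem_lrCrossingAt hωE hOL
  obtain ⟨xj, yj, Tj, hxj, hyj, hTjs, hTje⟩ := exists_walk_of_mem_lrCrossingAt hωE hIL
  simp only [Matrix.cons_val_zero, Matrix.cons_val_one] at hxl hyl hTls hxj hyj hTjs
  obtain ⟨ml, hml, Ul, hUls, hUle⟩ := AL.exists_walk_of_outerCorridor' (by omega) hE Tl.reverse
    (by rw [hyl]; omega) (by rw [hxl]; omega)
    (fun z hz => by
      rw [Walk.support_reverse, List.mem_reverse] at hz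
      exact ⟨by have := (hTls z hz).2.1; omega, fun _ => ⟨(hTls z hz).2.2.1, by have := (hTls z hz).2.2.2; omega⟩⟩)
  obtain ⟨mj, hmj, Uj, hUjs, hUje⟩ := AL.exists_walk_of_innerCorridor' (by omega) he Tj.reverse
    hxj (by rw [hyj]; omega)
    (fun z hz => by
      rw [Walk.support_reverse, List.mem_reverse] at hz
      exact ⟨by have := (hTjs z hz).1; omega, fun _ => ⟨(hTjs z hz).2.2.1, by have := (hTjs z hz).2.2.2; omega⟩⟩)
  have hyj1 := (hTjs yj Tj.end_mem_support).2.2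
  obtain ⟨tipl, HWl, htipl0, htipl1, hHWls, hHWle⟩ := exists_hubWalkL (k / 2 - 1) (k / 4) (k / 64) (t := yj 1)
    hyj1.1 (by have := hyj1.2; omega)
  obtain rfl : tipl = yj := LatticeModels.Site.eq_iff_two.2 ⟨by rw [htipl0, hyj]; omega, htipl1⟩
  have hmj' : mj ∈ Tj.reverse.support := hmj
  have hml' : ml ∈ Tl.reverse.support := hml
  obtain ⟨P₁, hP₁e, hP₁s⟩ := exists_composedArm HWl Tj.reverse hmj' Uj Ul Tl.reverse hml'
    (fun e he' => mem_of_mem_zdHub_of_mem_hubOpen hKa hHub (hHWle e he'))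
    (fun e he' => hTje e (by simpa using he')) hUje hUle (fun e he' => hTle e (by simpa using he'))
  -- ### supports
  have annR : ∀ z ∈ sqAnnulus k N, |z 0| ≤ N ∧ |z 1| ≤ N ∧ ((k : ℤ) ≤ |z 0| ∨ (k : ℤ) ≤ |z 1|) := by
    intro z hz
    rw [mem_sqAnnulus_iff (by omega), Fin.forall_fin_two, Fin.exists_fin_two] at hz
    obtain ⟨⟨h0, h1⟩, h2⟩ := hz
    refine ⟨abs_le.2 ⟨h0.1, h0.2⟩, abs_le.2 ⟨h1.1, h1.2⟩, ?_⟩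
    rcases h2 with h2 | h2 <;> [left; right] <;> rw [le_abs] <;> omega
  refine ⟨xl, yo, yo', P₁, P₃, P₄, hxl, by rw [hyo]; omega, by rw [hyo']; omega, fun z hz => ?_, fun z hz => ?_,
    fun z hz => ?_, hP₁e, hP₃e, hP₄e, fun z hz₃ hz₄ => ?_⟩
  · rcases hP₁s z hz with h | h | h | h | h
    · rcases hHWls z h with h | h | h <;> exact ⟨by omega, by omega, abs_le.2 ⟨by omega, by omega⟩⟩
    · rw [Walk.support_reverse, List.mem_reverse] at h
      have := hTjs z h; exact ⟨by omega, by omega, abs_le.2 ⟨by omega, by omega⟩⟩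
    · have := zoneL_bd z (hALZ (hUjs z h))
      have e0 := abs_le.1 this.1
      exact ⟨by omega, by omega, by have := this.2; omega⟩
    · have := zoneL_bd z (hALZ (hUls z h))
      have e0 := abs_le.1 this.1
      exact ⟨by omega, by omega, by have := this.2; omega⟩
    · rw [Walk.support_reverse, List.mem_reverse] at h
      have := hTls z h; exact ⟨by omega, by omega, abs_le.2 ⟨by omega, by omega⟩⟩
  · rcases hP₃s z hz with h | h | h | h | h
    · rcases hHWs z h with h | h | h | h <;> exact ⟨by omega, by omega, abs_le.2 ⟨by omega, by omega⟩⟩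
    · have := hTis z h; exact ⟨by omega, by omega, abs_le.2 ⟨by omega, by omega⟩⟩
    · have := zoneR_bd z (hApZ (hUis z h))
      have e0 := abs_le.1 this.1
      exact ⟨by omega, by omega, by have := this.2; omega⟩
    · have := zoneR_bd z (hApZ (hUos z h))
      have e0 := abs_le.1 this.1
      exact ⟨by omega, by omega, by have := this.2; omega⟩
    · have := hTos z h; exact ⟨by omega, by omega, abs_le.2 ⟨by omega, by omega⟩⟩
  · rcases hP₄s z hz with h | h | h | h | h
    · rcases hHWs' z h with h | h | h | h <;> exact ⟨by omega, by omega, abs_le.2 ⟨by omega, by omega⟩⟩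
    · have := hTis' z h; exact ⟨by omega, by omega, abs_le.2 ⟨by omega, by omega⟩⟩
    · have := zoneR_bd z (hAmZ (hUis' z h))
      have e0 := abs_le.1 this.1
      exact ⟨by omega, by omega, by have := this.2; omega⟩
    · have := zoneR_bd z (hAmZ (hUos' z h))
      have e0 := abs_le.1 this.1
      exact ⟨by omega, by omega, by have := this.2; omega⟩
    · have := hTos' z h; exact ⟨by omega, by omega, abs_le.2 ⟨by omega, by omega⟩⟩
  · -- ### disjointness of the two right arms off the origin
    -- classification of the sites of `P₃`: origin / positive non-annulus / carrier of `Ap`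
    have c3 : z = 0 ∨ (0 < z 1 ∧ z ∉ sqAnnulus k N) ∨ z ∈ Ap.carrier := by
      rcases hP₃s z hz₃ with h | h | h | h | h
      · rcases hHWs z h with h | h | h | h
        · rcases eq_or_lt_of_le h.2.1 with h1 | h1
          · left; exact LatticeModels.Site.eq_iff_two.2 ⟨h.1, h1.symm⟩
          · right; left; refine ⟨h1, fun ha => ?_⟩; have := (annR z ha).2.2; rw [le_abs, le_abs] at this; omega
        all_goals
          right; left; refine ⟨by omega, fun ha => ?_⟩
          have := (annR z ha).2.2; rw [le_abs, le_abs] at this; omega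
      · right; left
        have := hTis z h
        refine ⟨by omega, fun ha => ?_⟩
        have := (annR z ha).2.2; rw [le_abs, le_abs] at this; omega
      · exact Or.inr (Or.inr (hUis z h))
      · exact Or.inr (Or.inr (hUos z h))
      · right; left
        have := hTos z h
        refine ⟨by omega, fun ha => ?_⟩
        have := (annR z ha).1; rw [abs_le] at this; omega
    have c4 : z = 0 ∨ (z 1 < 0 ∧ z ∉ sqAnnulus k N) ∨ z ∈ Am.carrier := by
      rcases hP₄s z hz₄ with h | h | h | h | h
      · rcases hHWs' z h with h | h | h | h
        · rcases eq_or_lt_of_le h.2.2 with h1 | h1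
          · left; exact LatticeModels.Site.eq_iff_two.2 ⟨h.1, h1⟩
          · right; left; refine ⟨h1, fun ha => ?_⟩; have := (annR z ha).2.2; rw [le_abs, le_abs] at this; omega
        all_goals
          right; left; refine ⟨by omega, fun ha => ?_⟩
          have := (annR z ha).2.2; rw [le_abs, le_abs] at this; omega
      · right; left
        have := hTis' z h
        refine ⟨by omega, fun ha => ?_⟩
        have := (annR z ha).2.2; rw [le_abs, le_abs] at this; omega
      · exact Or.inr (Or.inr (hUis' z h))
      · exact Or.inr (Or.inr (hUos' z h))
      · right; left
        have := hTos' z h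
        refine ⟨by omega, fun ha => ?_⟩
        have := (annR z ha).1; rw [abs_le] at this; omega
    have sp : ∀ v ∈ Ap.carrier, v ∈ sqAnnulus k N ∨ 0 < v 1 := by
      intro v hv
      rcases Ap.carrier_cases hk8 hN8 hv with h | h | h
      · exact Or.inl h
      · right; omega
      · right; omega
    have sm : ∀ v ∈ Am.carrier, v ∈ sqAnnulus k N ∨ v 1 < 0 := by
      intro v hv
      rcases Am.carrier_cases hk8 hN8 hv with h | h | h
      · exact Or.inl h
      · right; omega
      · right; omega
    rcases c3 with h3 | h3 | h3
    · exact h3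
    · rcases c4 with h4 | h4 | h4
      · exact h4
      · omega
      · rcases sm z h4 with h | h
        · exact absurd h h3.2
        · omega
    · rcases c4 with h4 | h4 | h4
      · exact h4
      · rcases sp z h3 with h | h
        · exact absurd h h4.2
        · omega
      · exact (Set.disjoint_left.1 hdisj h3 h4).elim

end UOpenArms

/-! ### The dual arms of `(U)` in the hub frame -/

section UDualArms

/-- Gluing lemmas for dual arms with general landing parameters (re-typed). [folklore] -/
theorem ZdSepDualArmT.exists_faceWalk_of_outerCorridor' {ω : BondConfig (Site 2)} {n N : ℕ} {lo hi lo' hi' : ℤ}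
    {s y : Site 2} (A : ZdSepDualArmT ω n N lo hi lo' hi') (hhi' : hi' = lo' + (N / 64 : ℕ)) (hE : 1 ≤ N / 8)
    (T : (zdGraph 2).Walk s y) (hs : s 1 = N + 1) (hy : (N : ℤ) + (N / 8 : ℕ) ≤ y 1)
    (hT : ∀ z ∈ T.support, (N : ℤ) + 1 ≤ z 1 ∧ (z 1 ≤ N + (N / 8 : ℕ) → lo' ≤ z 0 ∧ z 0 ≤ lo' + (N / 64 : ℕ))) :
    ∃ m ∈ T.support, ∃ U : (zdGraph 2).Walk A.f m,
      (∀ z ∈ U.support, z ∈ A.Q.support ∨ z ∈ A.P.support ∨ z ∈ A.C.support) ∧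
      (∀ d ∈ U.darts, sepEdge d.fst d.snd ∉ ω) := by
  subst hhi'
  obtain ⟨m, hm, U, h1, h2, -⟩ := A.exists_faceWalk_of_outerCorridor hE T hs hy hT
  exact ⟨m, hm, U, h1, h2⟩

/-- Inner gluing, top dual arm, with general landing parameters (re-typed). [folklore] -/
theorem ZdSepDualArmT.exists_faceWalk_of_innerCorridor' {ω : BondConfig (Site 2)} {n N : ℕ} {lo hi lo' hi' : ℤ}
    {s y : Site 2} (A : ZdSepDualArmT ω n N lo hi lo' hi') (hhi : hi = lo + (n / 64 : ℕ)) (he : 1 ≤ n / 8)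
    (T : (zdGraph 2).Walk s y) (hy : y 1 + 2 = n) (hs : s 1 ≤ (n : ℤ) - 1 - (n / 8 : ℕ))
    (hT : ∀ z ∈ T.support, z 1 + 2 ≤ n ∧ ((n : ℤ) - 1 - (n / 8 : ℕ) ≤ z 1 → lo ≤ z 0 ∧ z 0 ≤ lo + (n / 64 : ℕ))) :
    ∃ m ∈ T.support, ∃ U : (zdGraph 2).Walk A.f m,
      (∀ z ∈ U.support, z ∈ A.P'.support ∨ z ∈ A.C'.support) ∧
      (∀ d ∈ U.darts, sepEdge d.fst d.snd ∉ ω) := by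
  subst hhi
  obtain ⟨m, hm, U, h1, h2, -⟩ := A.exists_faceWalk_of_innerCorridor he T hy hs hT
  exact ⟨m, hm, U, h1, h2⟩

/-- Outer gluing, bottom dual arm, with general landing parameters (re-typed). [folklore] -/
theorem ZdSepDualArmB.exists_faceWalk_of_outerCorridor' {ω : BondConfig (Site 2)} {n N : ℕ} {lo hi lo' hi' : ℤ}
    {s y : Site 2} (A : ZdSepDualArmB ω n N lo hi lo' hi') (hhi' : hi' = lo' + (N / 64 : ℕ)) (hE : 1 ≤ N / 8)
    (T : (zdGraph 2).Walk s y) (hs : s 1 + 2 = -(N : ℤ)) (hy : y 1 ≤ -(N : ℤ) - 1 - (N / 8 : ℕ))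
    (hT : ∀ z ∈ T.support, z 1 + 2 ≤ -(N : ℤ) ∧ (-(N : ℤ) - 1 - (N / 8 : ℕ) ≤ z 1 → lo' ≤ z 0 ∧ z 0 ≤ lo' + (N / 64 : ℕ))) :
    ∃ m ∈ T.support, ∃ U : (zdGraph 2).Walk A.f m,
      (∀ z ∈ U.support, z ∈ A.Q.support ∨ z ∈ A.P.support ∨ z ∈ A.C.support) ∧
      (∀ d ∈ U.darts, sepEdge d.fst d.snd ∉ ω) := by
  subst hhi'
  obtain ⟨m, hm, U, h1, h2, -⟩ := A.exists_faceWalk_of_outerCorridor hE T hs hy hT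
  exact ⟨m, hm, U, h1, h2⟩

/-- Inner gluing, bottom dual arm, with general landing parameters (re-typed). [folklore] -/
theorem ZdSepDualArmB.exists_faceWalk_of_innerCorridor' {ω : BondConfig (Site 2)} {n N : ℕ} {lo hi lo' hi' : ℤ}
    {s y : Site 2} (A : ZdSepDualArmB ω n N lo hi lo' hi') (hhi : hi = lo + (n / 64 : ℕ)) (he : 1 ≤ n / 8)
    (T : (zdGraph 2).Walk s y) (hy : y 1 = -(n : ℤ) + 1) (hs : -(n : ℤ) + (n / 8 : ℕ) ≤ s 1)
    (hT : ∀ z ∈ T.support, -(n : ℤ) + 1 ≤ z 1 ∧ (z 1 ≤ -(n : ℤ) + (n / 8 : ℕ) → lo ≤ z 0 ∧ z 0 ≤ lo + (n / 64 : ℕ))) :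
    ∃ m ∈ T.support, ∃ U : (zdGraph 2).Walk A.f m,
      (∀ z ∈ U.support, z ∈ A.P'.support ∨ z ∈ A.C'.support) ∧
      (∀ d ∈ U.darts, sepEdge d.fst d.snd ∉ ω) := by
  subst hhi
  obtain ⟨m, hm, U, h1, h2, -⟩ := A.exists_faceWalk_of_innerCorridor he T hy hs hT
  exact ⟨m, hm, U, h1, h2⟩

/-- A horizontal unit edge of a row, located by the coordinates of its left endpoint. [folklore] -/
theorem mk_add_single_zero_mem_rowEdges {c₀ r : ℤ} {w : ℕ} {x : Site 2} (h1 : x 1 = r) (hc : c₀ ≤ x 0)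
    (hc' : x 0 ≤ c₀ + w) : s(x, x + Pi.single 0 1) ∈ rowEdges c₀ r w := by
  have hx : x = ![x 0, r] := LatticeModels.Site.eq_iff_two.2 ⟨by simp, by simp [h1]⟩
  have hx' : x + Pi.single 0 1 = ![x 0 + 1, r] := LatticeModels.Site.eq_iff_two.2 ⟨by simp, by simp [h1]⟩
  rw [hx', hx]
  simpa using mk_mem_rowEdges (r := r) hc hc'

/-- **The step down from the face `z + e₁` to the face `z`** crosses the edge `{z + e₁, z + e₁ + e₀}`.
[folklore] -/
theorem sepEdge_down_eq (z : Site 2) :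
    sepEdge (z + Pi.single 1 1) z = s(z + Pi.single 1 1, z + Pi.single 1 1 + Pi.single 0 1) := by
  rw [sepEdge_comm, sepEdge_up]

/-- **Composition of an extended dual arm** (outer corridor down to its meeting point with the
outer gluing walk, outer gluing walk reversed, inner gluing walk, inner corridor from the meeting
point to its end, one extra step, hub path). [folklore] -/
theorem exists_composedDualArm {ω : BondConfig (Site 2)} {a f mo mi bi c g : Site 2}
    (Wo : (zdGraph 2).Walk a mo) (Uo : (zdGraph 2).Walk f mo) (Ui : (zdGraph 2).Walk f mi)
    (Wi : (zdGraph 2).Walk mi bi) (hstep : (zdGraph 2).Adj bi c) (Uh : (zdGraph 2).Walk c g)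
    (h1 : ∀ d ∈ Wo.darts, sepEdge d.fst d.snd ∉ ω) (h2 : ∀ d ∈ Uo.darts, sepEdge d.fst d.snd ∉ ω)
    (h3 : ∀ d ∈ Ui.darts, sepEdge d.fst d.snd ∉ ω) (h4 : ∀ d ∈ Wi.darts, sepEdge d.fst d.snd ∉ ω)
    (h5 : sepEdge bi c ∉ ω) (h6 : ∀ d ∈ Uh.darts, sepEdge d.fst d.snd ∉ ω) :
    ∃ Q : (zdGraph 2).Walk a g, (∀ d ∈ Q.darts, sepEdge d.fst d.snd ∉ ω) ∧
      ∀ z ∈ Q.support, z ∈ Wo.support ∨ z ∈ Uo.support ∨ z ∈ Ui.support ∨ z ∈ Wi.support ∨ z ∈ Uh.support := by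
  refine ⟨Wo.append (Uo.reverse.append (Ui.append (Wi.append (Walk.cons hstep Uh)))), fun d hd => ?_, fun z hz => ?_⟩
  · simp only [Walk.darts_append, List.mem_append, Walk.darts_cons, List.mem_cons] at hd
    rcases hd with hd | hd | hd | hd | rfl | hd
    · exact h1 d hd
    · exact sepEdge_forall_darts_reverse (P := fun e => e ∉ ω) h2 d hd
    · exact h3 d hd
    · exact h4 d hd
    · exact h5
    · exact h6 d hd
  · simp only [Walk.mem_support_append_iff, Walk.support_reverse, List.mem_reverse, Walk.support_cons,
      List.mem_cons] at hz
    rcases hz with hz | hz | hz | hz | rfl | hz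
    · exact Or.inl hz
    · exact Or.inr (Or.inl hz)
    · exact Or.inr (Or.inr (Or.inl hz))
    · exact Or.inr (Or.inr (Or.inr (Or.inl hz)))
    · exact Or.inr (Or.inr (Or.inr (Or.inl (Wi.end_mem_support))))
    · exact Or.inr (Or.inr (Or.inr (Or.inr hz)))

variable {k N WL ER SB NT : ℕ}

/-- **The two extended dual arms of `(U)`** (hub frame): on `uGlued`, a walk of faces from the
face `(-1, 0)` north-west of the origin UP to the top face row `{f₁ = NT}` and one from the face
`(-1, -1)` south-west of the origin DOWN to the bottom face row `{f₁ = -SB-1}`, all of whose steps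
cross closed edges, inside `{|f₀| ≤ 3N - 1, -SB-1 ≤ f₁ ≤ NT}`. [cite: Nolin2008, §4.5, proof of Prop. 17; KestenSidoraviciusZhang1998, (3.10)] -/
theorem uGlued_dualArms (hk : 128 ≤ k) (hN : 2 * k ≤ N) (hSB : 3 * N ≤ SB) (hNT : 3 * N ≤ NT)
    {ω : BondConfig (Site 2)} (hω : ω ∈ uGlued k N WL ER SB NT) :
    ∃ (t s : Site 2) (Q₂ : (zdGraph 2).Walk ![-1, 0] t) (Q₅ : (zdGraph 2).Walk ![-1, -1] s),
      t 1 = NT ∧ s 1 = -(SB : ℤ) - 1 ∧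
      (∀ z ∈ Q₂.support, |z 0| + 1 ≤ 3 * N ∧ -(SB : ℤ) - 1 ≤ z 1 ∧ z 1 ≤ NT) ∧
      (∀ z ∈ Q₅.support, |z 0| + 1 ≤ 3 * N ∧ -(SB : ℤ) - 1 ≤ z 1 ∧ z 1 ≤ NT) ∧
      (∀ d ∈ Q₂.darts, sepEdge d.fst d.snd ∉ ω) ∧ (∀ d ∈ Q₅.darts, sepEdge d.fst d.snd ∉ ω) := by
  obtain ⟨⟨⟨-, ⟨AT⟩, ⟨AB⟩⟩, -, ⟨hOT, hOB⟩, ⟨hIT, hRT⟩, hIB, hRB⟩, hHub⟩ := hω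
  have hE : 1 ≤ N / 8 := by omega
  have he : 1 ≤ k / 8 := by omega
  have haK : ((k / 4 : ℕ) : ℤ) + 1 ≤ ((k / 2 - 1 : ℕ) : ℤ) := by omega
  have hhK : ((k / 64 : ℕ) : ℤ) + 1 ≤ ((k / 2 - 1 : ℕ) : ℤ) := by omega
  have hub_closed : ∀ e, e ∈ hubPairs (k / 2 - 1) ∧ e ∉ hubOpen (k / 2 - 1) (k / 4) (k / 64) → e ∉ ω :=
    fun e ⟨h1, h2⟩ h3 => h2 ((hHub e h1).1 h3)
  -- ### top
  obtain ⟨a, b, W, ha, hb, hWs, hWd⟩ := hOT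
  obtain ⟨a', b', W', ha', hb', hW's, hW'd⟩ := hIT
  simp only [Matrix.cons_val_zero, Matrix.cons_val_one] at ha hb hWs ha' hb' hW's
  obtain ⟨mT, hmT, UT, hUTs, hUTc⟩ := AT.exists_faceWalk_of_outerCorridor' (by omega) hE W.reverse (by rw [hb]; omega)
    (by rw [ha]; omega)
    (fun z hz => by
      rw [Walk.support_reverse, List.mem_reverse] at hz
      exact ⟨by have := (hWs z hz).2.2.1; omega, fun _ => ⟨(hWs z hz).1, by have := (hWs z hz).2.1; omega⟩⟩)
  obtain ⟨m'T, hm'T, U'T, hU'Ts, hU'Tc⟩ := AT.exists_faceWalk_of_innerCorridor' (by omega) he W'.reverse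
    (by rw [ha']; omega) (by rw [hb']; omega)
    (fun z hz => by
      rw [Walk.support_reverse, List.mem_reverse] at hz
      exact ⟨by have := (hW's z hz).2.2.2; omega, fun _ => ⟨(hW's z hz).1, by have := (hW's z hz).2.1; omega⟩⟩)
  rw [Walk.support_reverse, List.mem_reverse] at hmT hm'T
  have hb'0 := (hW's b' W'.end_mem_support)
  obtain ⟨fT, UhT, hfT0, hfT1, hUhTs, hUhTd⟩ := exists_hubDualPathT (k / 2 - 1) (k / 4) (k / 64) haK hhK
    (b := b' 0) hb'0.1 (by have := hb'0.2.1; omega)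
  have hb'eq : b' = fT + Pi.single 1 1 :=
    LatticeModels.Site.eq_iff_two.2 ⟨by simp [hfT0], by simp [hfT1, hb']; omega⟩
  have hstepT : (zdGraph 2).Adj b' fT := by rw [hb'eq]; exact adj_of_stepKind (.down (by simp) (by simp))
  have hsepT : sepEdge b' fT ∉ ω := by
    rw [hb'eq, sepEdge_down_eq, ← hb'eq]
    exact hRT _ (mk_add_single_zero_mem_rowEdges (by omega) hb'0.1 (by have := hb'0.2.1; omega))
  obtain ⟨Q₂r, hQ₂d, hQ₂s⟩ := exists_composedDualArm (W.takeUntil mT hmT) UT U'T (W'.dropUntil m'T hm'T) hstepT UhT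
    (fun d hd => hWd d (W.darts_takeUntil_subset_darts hmT hd)) hUTc hU'Tc
    (fun d hd => hW'd d (W'.darts_dropUntil_subset_darts hm'T hd)) hsepT (fun d hd => hub_closed _ (hUhTd d hd))
  -- ### bottom
  obtain ⟨a₃, b₃, W₃, ha₃, hb₃, hW₃s, hW₃d⟩ := hOB
  obtain ⟨a'', b'', W'', ha'', hb'', hW''s, hW''d⟩ := hIB
  simp only [Matrix.cons_val_zero, Matrix.cons_val_one] at ha₃ hb₃ hW₃s ha'' hb'' hW''s
  obtain ⟨mB, hmB, UB, hUBs, hUBc⟩ := AB.exists_faceWalk_of_outerCorridor' (by omega) hE W₃ (by rw [ha₃]; omega)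
    (by rw [hb₃]; omega)
    (fun z hz => ⟨by have := (hW₃s z hz).2.2.2; omega, fun _ => ⟨(hW₃s z hz).1, by have := (hW₃s z hz).2.1; omega⟩⟩)
  obtain ⟨m'B, hm'B, U'B, hU'Bs, hU'Bc⟩ := AB.exists_faceWalk_of_innerCorridor' (by omega) he W''
    (by rw [hb'']; omega) (by rw [ha'']; omega)
    (fun z hz => ⟨by have := (hW''s z hz).2.2.1; omega, fun _ => ⟨(hW''s z hz).1, by have := (hW''s z hz).2.1; omega⟩⟩)
  have ha''0 := (hW''s a'' W''.start_mem_support)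
  obtain ⟨fB, UhB, hfB0, hfB1, hUhBs, hUhBd⟩ := exists_hubDualPathB (k / 2 - 1) (k / 4) (k / 64) haK hhK
    (b := a'' 0) ha''0.1 (by have := ha''0.2.1; omega)
  have hfBeq : fB = a'' + Pi.single 1 1 :=
    LatticeModels.Site.eq_iff_two.2 ⟨by simp [hfB0], by simp [hfB1, ha'']; omega⟩
  have hstepB : (zdGraph 2).Adj fB a'' := by rw [hfBeq]; exact adj_of_stepKind (.down (by simp) (by simp))
  have hsepB : sepEdge fB a'' ∉ ω := by
    rw [hfBeq, sepEdge_down_eq, ← hfBeq]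
    exact hRB _ (mk_add_single_zero_mem_rowEdges (x := fB) (by omega) (by rw [hfB0]; exact ha''0.1)
      (by rw [hfB0]; have := ha''0.2.1; omega))
  -- assemble the bottom walk directly: hub path, step, inner corridor to the meeting point, inner
  -- gluing walk (reversed), outer gluing walk, outer corridor from the meeting point
  have hk1 : 1 ≤ k := by omega
  have hkN : k ≤ N := by omega
  refine ⟨a, b₃, Q₂r.reverse,
    UhB.append (Walk.cons hstepB ((W''.takeUntil m'B hm'B).append (U'B.reverse.append (UB.append (W₃.dropUntil mB hmB))))),
    ha.trans (by omega), hb₃.trans (by omega), fun z hz => ?_, fun z hz => ?_, ?_, fun d hd => ?_⟩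
  · rw [Walk.support_reverse, List.mem_reverse] at hz
    rcases hQ₂s z hz with h | h | h | h | h
    · have := hWs z (W.support_takeUntil_subset_support hmT h)
      exact ⟨by rw [abs_of_nonneg this.1]; omega, by omega, by omega⟩
    · have := AT.face_bounds hk1 hkN (by omega) (by omega) (by omega) (by omega) (Or.inl (hUTs z h))
      have e0 := abs_le.1 this.1
      exact ⟨by have h' : |z 0| ≤ 3 * (N : ℤ) - 1 := abs_le.2 ⟨by omega, by omega⟩; omega, by omega, by omega⟩
    · have := AT.face_bounds hk1 hkN (by omega) (by omega) (by omega) (by omega) (Or.inr (hU'Ts z h))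
      have e0 := abs_le.1 this.1
      exact ⟨by have h' : |z 0| ≤ 3 * (N : ℤ) - 1 := abs_le.2 ⟨by omega, by omega⟩; omega, by omega, by omega⟩
    · have := hW's z (W'.support_dropUntil_subset_support hm'T h)
      exact ⟨by rw [abs_of_nonneg this.1]; omega, by omega, by omega⟩
    · have := hUhTs z h
      exact ⟨by have h' : |z 0| ≤ 3 * (N : ℤ) - 1 := abs_le.2 ⟨by omega, by omega⟩; omega, by omega, by omega⟩
  · simp only [Walk.mem_support_append_iff, Walk.support_cons, List.mem_cons, Walk.support_reverse,
      List.mem_reverse] at hz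
    rcases hz with h | rfl | h | h | h | h
    · have := hUhBs z h
      exact ⟨by have h' : |z 0| ≤ 3 * (N : ℤ) - 1 := abs_le.2 ⟨by omega, by omega⟩; omega, by omega, by omega⟩
    · exact ⟨by have h' : |z 0| ≤ 3 * (N : ℤ) - 1 := abs_le.2 ⟨by omega, by omega⟩; omega, by omega, by omega⟩
    · have := hW''s z (W''.support_takeUntil_subset_support hm'B h)
      exact ⟨by rw [abs_of_nonneg this.1]; omega, by omega, by omega⟩
    · have := AB.face_bounds hk1 hkN (by omega) (by omega) (by omega) (by omega) (Or.inr (hU'Bs z h))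
      have e0 := abs_le.1 this.1
      exact ⟨by have h' : |z 0| ≤ 3 * (N : ℤ) - 1 := abs_le.2 ⟨by omega, by omega⟩; omega, by omega, by omega⟩
    · have := AB.face_bounds hk1 hkN (by omega) (by omega) (by omega) (by omega) (Or.inl (hUBs z h))
      have e0 := abs_le.1 this.1
      exact ⟨by have h' : |z 0| ≤ 3 * (N : ℤ) - 1 := abs_le.2 ⟨by omega, by omega⟩; omega, by omega, by omega⟩
    · have := hW₃s z (W₃.support_dropUntil_subset_support hmB h)
      exact ⟨by rw [abs_of_nonneg this.1]; omega, by omega, by omega⟩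
  · exact sepEdge_forall_darts_reverse (P := fun e => e ∉ ω) hQ₂d
  · simp only [Walk.darts_append, List.mem_append, Walk.darts_cons, List.mem_cons, Walk.darts_reverse,
      List.mem_reverse, List.mem_map] at hd
    rcases hd with hd | rfl | hd | ⟨d', hd', rfl⟩ | hd | hd
    · exact hub_closed _ (hUhBd d hd)
    · exact hsepB
    · exact hW''d d (W''.darts_takeUntil_subset_darts hm'B hd)
    · rw [sepEdge_dart_symm]; exact hU'Bc d' hd'
    · exact hUBc d hd
    · exact hW₃d d (W₃.darts_dropUntil_subset_darts hmB hd)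

end UDualArms

/-! ### `(U)`: the glued event is a translate of KSZ's landed five-arm event -/

section UKSZ

variable {k N WL ER SB NT : ℕ}

/-- **On `uGlued`, KSZ's landed five-arm event holds at `v = (WL, SB)` for the shifted
configuration**, in the rectangle `[0, WL + ER] × [0, SB + NT]`: the three extended open arms and
the two extended dual arms of the hub frame, translated by `v`, made into paths (`bypass`), the
left–right vertex-disjointness coming from the dual arms (`ZdFiveArmKSZ.mem_support_of_dual`).
[cite: KestenSidoraviciusZhang1998, proof of Lemma 5, (3.10)] [cite: Nolin2008, §4.5 Prop. 17 and §5.2 Thm. 24] -/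
theorem relabel_shift_mem_zdFiveArmKSZ_of_mem_uGlued (hk : 128 ≤ k) (hN : 2 * k ≤ N)
    (hWL : 3 * N ≤ WL) (hER : 3 * N ≤ ER) (hSB : 3 * N ≤ SB) (hNT : 3 * N ≤ NT)
    {ω : BondConfig (Site 2)} (hωE : ω ⊆ (zdGraph 2).edgeSet) (hω : ω ∈ uGlued k N WL ER SB NT) :
    BondConfig.relabel (sym2Equiv (Site.shift (![(WL : ℤ), SB] : Site 2))) ω ∈
      zdFiveArmKSZ (WL + ER) (SB + NT) ![(WL : ℤ), SB] := by
  set v : Site 2 := ![(WL : ℤ), SB] with hv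
  set φ := (zdShiftIso v).toHom with hφ
  set ω' := BondConfig.relabel (sym2Equiv (Site.shift v)) ω with hω'
  have hv0 : v 0 = WL := by simp [hv]
  have hv1 : v 1 = SB := by simp [hv]
  have hN1 : 1 ≤ N := by omega
  obtain ⟨l, r, r', P₁, P₃, P₄, hl, hr, hr', hs₁, hs₃, hs₄, he₁, he₃, he₄, h₃₄⟩ :=
    uGlued_openArms hk hN hWL hER hωE hω
  obtain ⟨t, s, Q₂, Q₅, ht, hs, hQ₂s, hQ₅s, hQ₂c, hQ₅c⟩ := uGlued_dualArms (WL := WL) (ER := ER) hk hN hSB hNT hω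
  -- translation of the data
  have Eopen : ∀ {c d : Site 2} (P : (zdGraph 2).Walk c d), (∀ e ∈ P.edges, e ∈ ω) →
      ∀ e ∈ (P.map φ).edges, e ∈ ω' := by
    intro c d P hP e he
    obtain ⟨e', he', rfl⟩ := mem_edges_map_shift he
    exact (map_add_mem_relabel_shift_iff v ω e').2 (hP e' he')
  have Eclosed : ∀ {c d : Site 2} (Q : (zdGraph 2).Walk c d), (∀ dd ∈ Q.darts, sepEdge dd.fst dd.snd ∉ ω) →
      ∀ dd ∈ (Q.map φ).darts, sepEdge dd.fst dd.snd ∉ ω' := by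
    intro c d Q hQ dd hdd
    obtain ⟨d', hd', h1, h2⟩ := mem_darts_map_shift hdd
    rw [h1, h2, KSTPeriodic.sepEdge_add_right, hω', map_add_mem_relabel_shift_iff]
    exact hQ d' hd'
  have Esupp : ∀ {c d : Site 2} (P : (zdGraph 2).Walk c d),
      (∀ z ∈ P.support, -(WL : ℤ) ≤ z 0 ∧ z 0 ≤ ER ∧ |z 1| ≤ 3 * N) →
      ∀ z ∈ (P.map φ).support, (0 : ℤ) ≤ z 0 ∧ z 0 ≤ ((WL + ER : ℕ) : ℤ) ∧ (0 : ℤ) ≤ z 1 ∧ z 1 ≤ ((SB + NT : ℕ) : ℤ) := by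
    intro c d P hP z hz
    have h := hP _ (mem_support_map_shift.1 hz)
    simp only [Pi.sub_apply, hv0, hv1] at h
    have e1 := abs_le.1 h.2.2
    push_cast
    omega
  -- the three open paths
  set R₁ := ((P₁.map φ).copy (zero_add v) rfl).bypass with hR₁
  set R₃ := ((P₃.map φ).copy (zero_add v) rfl).bypass with hR₃
  set R₄ := ((P₄.map φ).copy (zero_add v) rfl).bypass with hR₄
  have sR₁ : ∀ z ∈ R₁.support, z ∈ (P₁.map φ).support := fun z hz => by
    have := Walk.support_bypass_subset_support _ hz; rwa [Walk.support_copy] at this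
  have sR₃ : ∀ z ∈ R₃.support, z ∈ (P₃.map φ).support := fun z hz => by
    have := Walk.support_bypass_subset_support _ hz; rwa [Walk.support_copy] at this
  have sR₄ : ∀ z ∈ R₄.support, z ∈ (P₄.map φ).support := fun z hz => by
    have := Walk.support_bypass_subset_support _ hz; rwa [Walk.support_copy] at this
  have eR₁ : ∀ e ∈ R₁.edges, e ∈ ω' := fun e he => by
    have := Walk.edges_bypass_subset_edges _ he; rw [Walk.edges_copy] at this; exact Eopen P₁ he₁ e this
  have eR₃ : ∀ e ∈ R₃.edges, e ∈ ω' := fun e he => by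
    have := Walk.edges_bypass_subset_edges _ he; rw [Walk.edges_copy] at this; exact Eopen P₃ he₃ e this
  have eR₄ : ∀ e ∈ R₄.edges, e ∈ ω' := fun e he => by
    have := Walk.edges_bypass_subset_edges _ he; rw [Walk.edges_copy] at this; exact Eopen P₄ he₄ e this
  have hl' : (φ l) 0 = 0 := by simp [hφ, hv0, hl]
  have hr0 : (φ r) 0 = ((WL + ER : ℕ) : ℤ) := by simp [hφ, hv0, hr]; ring
  have hr0' : (φ r') 0 = ((WL + ER : ℕ) : ℤ) := by simp [hφ, hv0, hr']; ring
  -- the joined dual walk, for the left–right disjointness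
  have hfNW : φ ![-1, 0] ∈ cornerFaces v := add_mem_cornerFaces (by rw [mem_cornerFaces_iff]; simp) v
  have hfSW : φ ![-1, -1] ∈ cornerFaces v := add_mem_cornerFaces (by rw [mem_cornerFaces_iff]; simp) v
  obtain ⟨J, hJ⟩ := ZdFiveArmKSZ.exists_cornerWalk hfNW hfSW
  have ht' : (φ t) 1 = ((SB + NT : ℕ) : ℤ) := by simp [hφ, hv1, ht]; ring
  have hs' : (φ s) 1 = -1 := by simp [hφ, hv1, hs]; ring
  have hQs : ∀ {c d : Site 2} (Q : (zdGraph 2).Walk c d),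
      (∀ z ∈ Q.support, |z 0| + 1 ≤ 3 * N ∧ -(SB : ℤ) - 1 ≤ z 1 ∧ z 1 ≤ NT) →
      ∀ z ∈ (Q.map φ).support, (0 : ℤ) ≤ z 0 ∧ z 0 + 1 ≤ ((WL + ER : ℕ) : ℤ) ∧ (-1 : ℤ) ≤ z 1 ∧ z 1 ≤ ((SB + NT : ℕ) : ℤ) := by
    intro c d Q hQ z hz
    have h := hQ _ (mem_support_map_shift.1 hz)
    simp only [Pi.sub_apply, hv0, hv1] at h
    have e1 := abs_le.1 (show |z 0 - WL| ≤ 3 * N - 1 by have := h.1; omega)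
    push_cast
    omega
  have hvv : 1 ≤ v 0 ∧ v 0 + 1 ≤ ((WL + ER : ℕ) : ℤ) ∧ 0 ≤ v 1 ∧ v 1 ≤ ((SB + NT : ℕ) : ℤ) := by
    rw [hv0, hv1]; push_cast; omega
  have hJs : ∀ z ∈ J.support, (0 : ℤ) ≤ z 0 ∧ z 0 + 1 ≤ ((WL + ER : ℕ) : ℤ) ∧ (-1 : ℤ) ≤ z 1 ∧ z 1 ≤ ((SB + NT : ℕ) : ℤ) :=
    fun z hz => ZdFiveArmKSZ.cornerFaces_bounds (hJ z hz) hvv.1 hvv.2.1 hvv.2.2.1 hvv.2.2.2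
  set Qt := (Q₂.map φ).reverse.append (J.append (Q₅.map φ)) with hQt
  have hQts : ∀ z ∈ Qt.support, (0 : ℤ) ≤ z 0 ∧ z 0 + 1 ≤ ((WL + ER : ℕ) : ℤ) ∧ (-1 : ℤ) ≤ z 1 ∧ z 1 ≤ ((SB + NT : ℕ) : ℤ) := by
    intro z hz
    rw [hQt, Walk.mem_support_append_iff, Walk.support_reverse, List.mem_reverse, Walk.mem_support_append_iff] at hz
    rcases hz with hz | hz | hz
    · exact hQs Q₂ hQ₂s z hz
    · exact hJs z hz
    · exact hQs Q₅ hQ₅s z hz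
  have hQtd : ∀ dd ∈ Qt.darts, sepEdge dd.fst dd.snd ∉ ω' ∨ (dd.fst ∈ cornerFaces v ∧ dd.snd ∈ cornerFaces v) := by
    intro dd hdd
    rw [hQt, Walk.darts_append, List.mem_append, Walk.darts_append, List.mem_append] at hdd
    rcases hdd with hdd | hdd | hdd
    · exact Or.inl (sepEdge_forall_darts_reverse (P := fun e => e ∉ ω') (Eclosed Q₂ hQ₂c) dd hdd)
    · exact Or.inr ⟨hJ _ (J.dart_fst_mem_support_of_mem_darts hdd), hJ _ (J.dart_snd_mem_support_of_mem_darts hdd)⟩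
    · exact Or.inl (Eclosed Q₅ hQ₅c dd hdd)
  -- left–right disjointness off `v`
  have hLR : ∀ {rr : Site 2} (R : (zdGraph 2).Walk v rr), R.IsPath → (rr 0 = ((WL + ER : ℕ) : ℤ)) →
      (∀ z ∈ R.support, (0 : ℤ) ≤ z 0 ∧ z 0 ≤ ((WL + ER : ℕ) : ℤ) ∧ (0 : ℤ) ≤ z 1 ∧ z 1 ≤ ((SB + NT : ℕ) : ℤ)) →
      (∀ e ∈ R.edges, e ∈ ω') → ∀ z ∈ R₁.support, z ∈ R.support → z = v := by
    intro rr R hRp hrr hRs hRe z hz₁ hz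
    by_contra hne
    have hne' : v ≠ z := fun h => hne h.symm
    set A := (R₁.dropUntil z hz₁).reverse.append (R.dropUntil z hz) with hA
    have hAs : ∀ w ∈ A.support, (0 : ℤ) ≤ w 0 ∧ w 0 ≤ ((WL + ER : ℕ) : ℤ) ∧ (0 : ℤ) ≤ w 1 ∧ w 1 ≤ ((SB + NT : ℕ) : ℤ) := by
      intro w hw
      rw [hA, Walk.mem_support_append_iff, Walk.support_reverse, List.mem_reverse] at hw
      rcases hw with hw | hw
      · exact Esupp P₁ hs₁ w (sR₁ w (R₁.support_dropUntil_subset_support hz₁ hw))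
      · exact hRs w (R.support_dropUntil_subset_support hz hw)
    have hAe : ∀ e ∈ A.edges, e ∈ ω' := by
      intro e he
      rw [hA, Walk.edges_append, List.mem_append, Walk.edges_reverse, List.mem_reverse] at he
      rcases he with he | he
      · exact eR₁ e (R₁.edges_dropUntil_subset_edges hz₁ he)
      · exact hRe e (R.edges_dropUntil_subset_edges hz he)
    have hvA := ZdFiveArmKSZ.mem_support_of_dual A hAs hl' hrr hAe Qt hQts ht' hs' hQtd
    rw [hA, Walk.mem_support_append_iff, Walk.support_reverse, List.mem_reverse] at hvA
    rcases hvA with h | h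
    · exact ZdFiveArmKSZ.not_mem_support_dropUntil (Walk.bypass_isPath _) hz₁ hne' h
    · exact ZdFiveArmKSZ.not_mem_support_dropUntil hRp hz hne' h
  refine mem_zdFiveArmKSZ_of_arms hvv.1 hvv.2.1 R₁ R₃ R₄ hl' hr0 hr0'
    (fun z hz => Esupp P₁ hs₁ z (sR₁ z hz)) (fun z hz => Esupp P₃ hs₃ z (sR₃ z hz)) (fun z hz => Esupp P₄ hs₄ z (sR₄ z hz))
    eR₁ eR₃ eR₄
    (hLR R₃ (Walk.bypass_isPath _) hr0 (fun z hz => Esupp P₃ hs₃ z (sR₃ z hz)) eR₃)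
    (hLR R₄ (Walk.bypass_isPath _) hr0' (fun z hz => Esupp P₄ hs₄ z (sR₄ z hz)) eR₄)
    (fun z hz₃ hz₄ => ?_) hfNW hfSW (Q₂.map φ) ht' (hQs Q₂ hQ₂s) (Eclosed Q₂ hQ₂c) (Q₅.map φ) hs' (hQs Q₅ hQ₅s) (Eclosed Q₅ hQ₅c)
  have h3 := mem_support_map_shift.1 (sR₃ z hz₃)
  have h4 := mem_support_map_shift.1 (sR₄ z hz₄)
  have := h₃₄ _ h3 h4
  rw [sub_eq_zero] at this
  exact this

end UKSZ

/-! ### `(U)`: the point upper bound of the five-arm probability from separation -/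

section UPointBound

open _root_.MeasureTheory

variable {k N : ℕ}

/-- **KSZ's counting bound for the well-separated event**: for `128 ≤ k`, `2k ≤ N` and the RSW
constant `c` of aspect ratio `1024`,
`(2N+1)² · c¹⁰ 2^{-2(k/64+1)} 2^{-|hubPairs|} · P(zdFiveArmSep k N) ≤ 1` — the translates of the
glued event by the `(2N+1)²` vectors `v ∈ [3N, 5N]²` are contained in the pairwise disjoint
events `zdFiveArmKSZ (8N) (8N) v`. [cite: KestenSidoraviciusZhang1998, proof of Lemma 5, (3.11)] [cite: Nolin2008, §5.2, proof of Thm. 24] -/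
theorem real_zdFiveArmSep_mul_le_one (hk : 128 ≤ k) (hN : 2 * k ≤ N) {c : ℝ} (hc0 : 0 < c)
    (hc : ∀ l : ℕ, 1 ≤ l → c ≤ crossingProb half (1024 * l - 1) (l - 1)) :
    (2 * (N : ℝ) + 1) ^ 2 * (c ^ 10 * (1 / 2 : ℝ) ^ (2 * (k / 64 + 1)) * (1 / 2 : ℝ) ^ (hubPairs (k / 2 - 1)).card) *
        (bondPercolation (zdGraph 2) half).real (zdFiveArmSep k N) ≤ 1 := by
  classical
  set μ := bondPercolation (zdGraph 2) half with hμ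
  set b := c ^ 10 * (1 / 2 : ℝ) ^ (2 * (k / 64 + 1)) * (1 / 2 : ℝ) ^ (hubPairs (k / 2 - 1)).card with hb
  set I := Finset.Icc (3 * N) (5 * N) with hI
  set emb : ℕ × ℕ → Site 2 := fun q => ![(q.1 : ℤ), q.2] with hemb
  have hinj : Function.Injective emb := by
    intro q q' h
    have h0 := congrFun h 0
    have h1 := congrFun h 1
    simp only [hemb, Matrix.cons_val_zero, Matrix.cons_val_one, Nat.cast_inj] at h0 h1
    exact Prod.ext h0 h1
  set V := (I ×ˢ I).image emb with hV
  have hcard : V.card = (2 * N + 1) ^ 2 := by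
    rw [hV, Finset.card_image_of_injective _ hinj, Finset.card_product, hI, Nat.card_Icc]
    have : 5 * N + 1 - 3 * N = 2 * N + 1 := by omega
    rw [this, pow_two]
  have hsum := sum_real_zdFiveArmKSZ_le_one μ (8 * N) (8 * N) V
  have hterm : ∀ v ∈ V, b * μ.real (zdFiveArmSep k N) ≤ μ.real (zdFiveArmKSZ (8 * N) (8 * N) v) := by
    intro v hv
    rw [hV, Finset.mem_image] at hv
    obtain ⟨⟨WL, SB⟩, hq, rfl⟩ := hv
    rw [Finset.mem_product, hI, Finset.mem_Icc, Finset.mem_Icc] at hq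
    obtain ⟨⟨hWL, hWL'⟩, ⟨hSB, hSB'⟩⟩ := hq
    have hglue := real_uGlued_ge (WL := WL) (ER := 8 * N - WL) (SB := SB) (NT := 8 * N - SB) hk hN hWL hWL'
      (by omega) (by omega) hSB hSB' (by omega) hc0 hc
    have hM : WL + (8 * N - WL) = 8 * N := by omega
    have hNr : SB + (8 * N - SB) = 8 * N := by omega
    have hincl : uGlued k N WL (8 * N - WL) SB (8 * N - SB) ∩ {ω | ω ⊆ (zdGraph 2).edgeSet} ⊆
        BondConfig.relabel (sym2Equiv (Site.shift (emb (WL, SB)))) ⁻¹' zdFiveArmKSZ (8 * N) (8 * N) (emb (WL, SB)) := by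
      rintro ω ⟨hω, hωE⟩
      have := relabel_shift_mem_zdFiveArmKSZ_of_mem_uGlued hk hN hWL (by omega) hSB (by omega) hωE hω
      rw [hM, hNr] at this
      exact this
    calc b * μ.real (zdFiveArmSep k N) ≤ μ.real (uGlued k N WL (8 * N - WL) SB (8 * N - SB)) := hglue
      _ ≤ μ.real (BondConfig.relabel (sym2Equiv (Site.shift (emb (WL, SB)))) ⁻¹' zdFiveArmKSZ (8 * N) (8 * N) (emb (WL, SB))) := by
          refine ENNReal.toReal_mono (measure_ne_top _ _) (measure_mono_ae ?_)
          filter_upwards [ae_subset_edgeSet (zdGraph 2) half] with ω hωE hω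
          exact hincl ⟨hω, hωE⟩
      _ = μ.real (zdFiveArmKSZ (8 * N) (8 * N) (emb (WL, SB))) := bondPercolation_real_preimage_shift _ _ _
  have hle : ∑ v ∈ V, b * μ.real (zdFiveArmSep k N) ≤ ∑ v ∈ V, μ.real (zdFiveArmKSZ (8 * N) (8 * N) v) :=
    Finset.sum_le_sum hterm
  rw [Finset.sum_const, hcard, nsmul_eq_mul] at hle
  push_cast at hle
  linarith

/-- **The point upper bound `(U)` from Kesten's separation theorem.** If, for some `c > 0` and
`n₀`, `c · P(zdFiveArmClusters n N) ≤ P(zdFiveArmSep n N)` whenever `n₀ ≤ n` and `2n ≤ N`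
(Kesten 1987, Lemma 4; Nolin 2008, Thm. 11 with Prop. 12), then for `k = max n₀ 128` there is `C`
with `P(zdFiveArmClusters k N) ≤ C / N²` for all `N ≥ k` (KSZ 1998, Lemma 5; Nolin 2008,
Thm. 24 (3)). [cite: KestenSidoraviciusZhang1998, Lemma 5] [cite: Nolin2008, §5.2, Thm. 24] -/
theorem zdFiveArm_pointBound_of_separation
    (hsep : ∃ c : ℝ, 0 < c ∧ ∃ n₀ : ℕ, ∀ n N : ℕ, n₀ ≤ n → 2 * n ≤ N →
      c * (bondPercolation (zdGraph 2) half).real (zdFiveArmClusters n N) ≤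
        (bondPercolation (zdGraph 2) half).real (zdFiveArmSep n N)) :
    ∃ k : ℕ, 128 ≤ k ∧ ∃ C : ℝ, ∀ N : ℕ, k ≤ N →
      (bondPercolation (zdGraph 2) half).real (zdFiveArmClusters k N) ≤ C / (N : ℝ) ^ 2 := by
  obtain ⟨cs, hcs, n₀, hsep⟩ := hsep
  obtain ⟨c, hc0, hc⟩ := rsw_lowerBound_holds 1024 (by norm_num)
  set k := max n₀ 128 with hk
  have hk128 : 128 ≤ k := le_max_right _ _
  have hkn₀ : n₀ ≤ k := le_max_left _ _
  set b := c ^ 10 * (1 / 2 : ℝ) ^ (2 * (k / 64 + 1)) * (1 / 2 : ℝ) ^ (hubPairs (k / 2 - 1)).card with hb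
  have hb0 : 0 < b := by positivity
  refine ⟨k, hk128, 1 / (4 * cs * b) + 4 * (k : ℝ) ^ 2, fun N hkN => ?_⟩
  set μ := bondPercolation (zdGraph 2) half with hμ
  have hN0 : (0 : ℝ) < N := by exact_mod_cast (show 0 < N by omega)
  have hN2 : (0 : ℝ) < (N : ℝ) ^ 2 := by positivity
  rw [le_div_iff₀ hN2]
  have hk0 : 0 ≤ 4 * (k : ℝ) ^ 2 := by positivity
  have h4 : 0 ≤ 1 / (4 * cs * b) := by positivity
  by_cases h2 : 2 * k ≤ N
  · have h1 := real_zdFiveArmSep_mul_le_one hk128 h2 hc0 hc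
    rw [← hb] at h1
    have hs := hsep k N hkn₀ h2
    have hA : 4 * (N : ℝ) ^ 2 ≤ (2 * (N : ℝ) + 1) ^ 2 := by nlinarith [hN0]
    have hP : μ.real (zdFiveArmClusters k N) * (N : ℝ) ^ 2 ≤ 1 / (4 * cs * b) := by
      rw [le_div_iff₀ (by positivity)]
      calc μ.real (zdFiveArmClusters k N) * (N : ℝ) ^ 2 * (4 * cs * b)
          = 4 * (N : ℝ) ^ 2 * b * (cs * μ.real (zdFiveArmClusters k N)) := by ring
        _ ≤ 4 * (N : ℝ) ^ 2 * b * μ.real (zdFiveArmSep k N) :=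
            mul_le_mul_of_nonneg_left hs (by positivity)
        _ ≤ (2 * (N : ℝ) + 1) ^ 2 * b * μ.real (zdFiveArmSep k N) :=
            mul_le_mul_of_nonneg_right (mul_le_mul_of_nonneg_right hA hb0.le) measureReal_nonneg
        _ ≤ 1 := h1
    linarith [hP, hk0]
  · have h2' := not_le.1 h2
    have hle1 : μ.real (zdFiveArmClusters k N) ≤ 1 := measureReal_le_one
    have hNk : (N : ℝ) < 2 * k := by exact_mod_cast h2'
    have h3 : (N : ℝ) ^ 2 ≤ 4 * (k : ℝ) ^ 2 := by nlinarith [hNk, hN0]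
    calc μ.real (zdFiveArmClusters k N) * (N : ℝ) ^ 2 ≤ 1 * (4 * (k : ℝ) ^ 2) :=
          mul_le_mul hle1 h3 hN2.le zero_le_one
      _ ≤ 1 / (4 * cs * b) + 4 * (k : ℝ) ^ 2 := by linarith [h4]

end UPointBound

end Literature.Probability.Percolation
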